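import Mathlib
import Summits.QuantumFields.QCD.Theses.PauliWegnerSea
import Summits.QuantumFields.QCD.Theorems.PauliWegnerSeaFMClosureUnquenchedHopping
import Summits.QuantumFields.QCD.Theorems.PauliWegnerSeaFMClosureUnquenchedResolvent
import Summits.QuantumFields.QCD.Theorems.PauliWegnerSeaPauliBandLimit

/-!
# Line `von-mises-circles` — skeleton for crux `PauliWegnerSea.FMClosureUnquenched` (stmt-QuantumFields-11512)

Crux (fixed, by name): `FMClosureUnquenched = FibreCofactorDomination → TiltedFlatness → Core`,
`Core = ∀ Nf reg m > 0, Input → Conclusion` (one-scale phase-quenched shell bound ⇒ clause (ii) of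
`MobilityGap`).  Idea card `Cruxes/FMClosureUnquenched/Ideas/von-mises-circles.md` (ideator 2, round 1;
triage r1-1/2/3: pass — "support module: the fibre input of whichever outward line is picked"); line card
`Cruxes/FMClosureUnquenched/Lines/von-mises-circles.md`.

## Shape: a GRAFT on the picked line

The lead picked `thick-collar-far-stability` (`PICKED.md`) and its wave 1 (`LEAD-c1.md`) returned
`stub_twoStar : K1 → K3 → ∀ Nf, TwoStarBounds Nf` **blocked**: K1 as typed carries the extensive factor
`(1 + n_w)`, K3 speaks only for `β ≥ 0` and masses in `[-2,2]`, and (Tdec)/(T1) need a fibre decoupling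
the route never filed.  This line is that skeleton with `stub_twoStar` OPENED ALONG ABELIAN CIRCLES:

* `stub_fibreBandLaw`, first conjunct `CircleLaw` (M, the lever) — ONE-VARIABLE harmonic analysis: under any circle law
  `∝ e^{h(θ)} |J(θ)| dθ` with `h` a real trigonometric polynomial of bounded degree and `|h| ≤ κ`, `J` a
  trigonometric polynomial of bounded degree, every trigonometric polynomial `Q` of degree `≤ d` is
  FLAT (`sup |Q| ≤ C (1+κ)^p · mean |Q|`) and has NEGATIVE MOMENTS against its sup
  (`mean |Q|^{-s} ≤ C (1+κ)^p (sup |Q|)^{-s}`, `s ≤ s₀(d) < 1/(2d)`), constants depending on the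
  degrees only.  (Planning found that unimodality — the von Mises shape of first-harmonic tilts — is
  not needed for these SUP forms: any bounded-degree Gibbs tilt has density `≤ C κ^{1/2 + d_J}` on the
  circle; so no `2 ≤ L` hypothesis survives anywhere below.)
* `stub_fibreBandLaw`, second conjunct `FibreBandLaw` (L, the iteration) — on the fibre of `≤ n` links with the outside frozen, under
  the Wilson weight `e^{-β S_W}` tilted by `|P|` for ANY fibre polynomial `P` (e.g. `|det diracMatrix|`,
  all flavours, all masses) and for every `β ∈ ℝ`: flatness and negative moments of every fibre
  polynomial `Q` (depleted determinants, adjugate entries), constants `C(n,d) (1+|β|)^{p(n,d)}` —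
  uniform in the volume, the outside field and the masses.  Mechanism: disintegrate product Haar along
  the right cosets of the one-link circle letters `P₀₁, R₀₁, P₁₂, R₁₂` (the nine-letter words of the
  LANDED `Theorems/PauliWegnerSeaGluonicCompletionSu3CircleWord.lean` generate `SU(3)`; the averaging
  step is the LANDED `…HaarCurveStep.lean` in integral form), apply the circle law conditionally, and
  push `sup`/`inf` through the conditional expectations in the monotone direction (no measurable
  selection): after `9·n` letters the sup over all words is the sup over the fibre.
* `stub_cofactorDomination` (L) — K1♭ = `LocalCofactorDomination`, K1 IN UNIFORM SIDE-MATRIX FORM (= the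
  lead's `K2Repaired.FibreCofactorDominationUniform` extended to admissible side matrices, to `x = y`
  and to `m₀ ∈ [-9,1]`); the deterministic input every outward line consumes; recommended for promotion
  to a route item by the tenure planner.
* `stub_twoStar` (M–L) — `FibreBandLaw → LocalCofactorDomination → ∀ Nf, TwoStarBounds Nf`, the picked
  line's packaged two-star statement VERBATIM (all `β ∈ ℝ`, probe mass `∈ [-9,1]`, all sea masses, all
  `S`), by Hölder / reverse-Hölder glue on each two-star fibre: (T5) = K1♭ + Neg; (Tdec) = Cauchy–Schwarz +
  Neg for the depleted factor + reverse Hölder (Flat + Neg) for the full factor; (T1) = (T5)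
  conditionally on the stars of `u', v` (the inside and far factors are constant there); (T0) =
  Hölder³ + Neg, positivity of the weight from the landed a.e. non-vanishing of `det`.
* `stub_farStability`, `stub_unitShell`, `stub_inward`, `stub_closure` — the picked line's four open
  downstream stubs, BYTE-IDENTICAL (names, signatures, packaged `Prop`s), so that one registry serves
  both lines; `stub_resolvent` (p77083) and `stub_hopping` (p75265) are the landed theorems, imported.

Composition `FMClosureUnquenched_of : <type of stub_fibreBandLaw> → … → <type of stub_closure> →
FMClosureUnquenched` (sorry-free, hypotheses literally the seven stub statements), and
`FMClosureUnquenched_of_stubs : FMClosureUnquenched` instantiates it with the seven `stub_*` (the theorem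
the layer audit reads).  K1 and K3 (the crux's own hypotheses) are threaded to `stub_farStability`
exactly as in the picked line; the fibre half no longer leans on them (it proves more: `β ∈ ℝ`, all
masses — LEAD-c1 points 1–2 for the fibre package), and as a by-product `FibreBandLaw` with
`Q = P = det diracMatrix` gives route item `TiltedFlatness` (stmt-14070) in negative-moment form.

## Disproof.lean / negatives honoured (cycle 2 file, 05:05Z)
§1 guard (`refutation_cost`): nothing here is `¬K2`; §2 decoration: the fibre stubs are mass-blind by
construction (degree, not mass); §4 A5 corner: isolated as `stub_unitShell` (shared); §5 A6: `stub_inward`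
(shared); §6 `outward_bootstrap`: consumed inside `stub_closure` via the lead's landed
`SubharmonicIterationDecay`; §8 non-vacuity: consistent (heavy sea is in the hopping window); §9 Targets:
the five picked-line stubs un-broken — the four reused here verbatim.  No `_false_without_` theorem and no
landed `Theorems/FMClosureUnquenched/Negative/` lemma exist, so no stub instantiates one.  Negatives index
(9494, 9599, 9603, 9665: MultibosonBridge ladders, diagonal-mirror RP, adaptive coarse system): untouched.

## Reshape (lead gen 1, prover-line-stmt-QuantumFields-11512-1, 2026-08-16)

Seven registered stubs, same composition idea: `stub_circleLaw` (1a, `∀ d dJ dh, CircleLaw d dJ dh`, held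
by the lead) and `stub_fibreBandLaw` (1b, `(∀ d dJ dh, CircleLaw d dJ dh) → FibreBandLaw`) replace the
former conjunction; `stub_corners` = former `stub_unitShell ∧ stub_inward` (the A5/A6 corners of the crux as
typed, mooted by `K2Repaired`, carried unchanged so that `FMClosureUnquenched_of_stubs` still concludes the
crux by name); `stub_deterministic` = former `stub_cofactorDomination` ∧ the NEW `SideWitness` (one invertible
field per admissible side matrix and probe mass), feeding the NEW clause (Tinv) of `TwoStarBounds` (a.e.
invertibility of the side matrices the resolvent identities invert — a junk-value gap of both parent
skeletons: `Matrix.inv` is `0` at singular matrices and (Rfwd)/(R2) carry invertibility hypotheses);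
`stub_twoStar` gains the hypothesis `SideWitness`; `stub_farStability`, `stub_closure` unchanged in text
(but `TwoStarBounds` now carries (Tinv)).

Sections §0–§2 below (crux quantities, side-matrix vocabulary, the packaged stub predicates) are copied
VERBATIM from `Lines/thick_collar_far_stability.lean` (sha256 57b57a2a66dc…, the lead's registered
skeleton); §3 is this line's content (with two sorry-free bridge lemmas showing the LANDED
`PauliBandLimit_proof` feeds `IsTrigPoly 4` / the `IsFibrePoly` orbit condition); §4 the registered stubs;
§5 the kernel-checked composition.
-/

noncomputable section

namespace Summit.QuantumFields.QCD.Cruxes.FMClosureUnquenched.VonMisesCircles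

open scoped BigOperators
open MeasureTheory Filter
open Literature.MathematicalPhysics.QuantumFieldTheory Literature.MathematicalPhysics.QuantumLattice
  Literature.Probability.LatticeModels

local notation "𝔾" => Matrix.specialUnitaryGroup (Fin 3) ℂ
/-! ## §0 The crux's own quantities (verbatim integrands; copied from the picked line) -/

/-- Bare Wilson masses of the regularisation at step `k`: `m_f(k) = m_crit(k) + a_k m_f / Z_m(k)`
(verbatim the lambda of the crux). -/
def bareMass {Nf : ℕ} (reg : QCDRegularisation Nf) (m : Fin Nf → ℝ) (k : ℕ) : Fin Nf → ℝ :=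
  fun fl => reg.mcrit k + reg.a k * m fl / reg.Zm k

/-- The crux's phase-quenched two-point fractional moment on the torus of side `2S+1` at coupling `β`
and bare masses `mq`: `E_{|w|}[(Σ_{a,i,b,j} |G_f((0,a,i),(v,b,j))|)^s]`, written EXACTLY as in
`FMClosureUnquenched` (ratio of Bochner integrals against `wilsonMeasure`, weight `‖det diracMatrix‖`). -/
def cruxMoment (Nf : ℕ) (β : ℝ) (mq : Fin Nf → ℝ) (S : ℕ) (f : Fin Nf)
    (v : Literature.Probability.LatticeModels.Site 4) (s : ℝ) : ℝ :=
  (∫ U : GaugeConfig 4 (2 * S + 1) (Matrix.specialUnitaryGroup (Fin 3) ℂ),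
      ‖(diracMatrix U mq).det‖ *
        (∑ a : Fin 3, ∑ i : Fin 4, ∑ b : Fin 3, ∑ j : Fin 4,
          ‖(diracMatrix U mq)⁻¹ (quarkEquiv (f, (Torus.proj (2 * S + 1) 0, a, i)))
            (quarkEquiv (f, (Torus.proj (2 * S + 1) (v), b, j)))‖) ^ s
      ∂(wilsonMeasure (fundamentalRep (Fin 3)) β)) /
    (∫ U : GaugeConfig 4 (2 * S + 1) (Matrix.specialUnitaryGroup (Fin 3) ℂ),
      ‖(diracMatrix U mq).det‖ ∂(wilsonMeasure (fundamentalRep (Fin 3)) β))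

/-- The crux's antecedent (the ONE-SCALE INPUT), verbatim up to the abbreviations above. -/
def Input (Nf : ℕ) (reg : QCDRegularisation Nf) (m : Fin Nf → ℝ) : Prop :=
  ∀ q : ℕ, ∃ K₀ s : ℝ, 0 < s ∧ s < 1 ∧ ∀ᶠ k in atTop, ∃ ℓ₀ : ℕ, 1 ≤ ℓ₀ ∧ ℓ₀ ≤ reg.L k ∧
    (ℓ₀ : ℝ) * reg.a k ≤ K₀ * (1 + |Real.log (reg.a k)|) ∧
    ∀ S : ℕ, reg.L k ≤ S → ∀ (f : Fin Nf) (v : Literature.Probability.LatticeModels.Site 4),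
      v ∈ box 4 S → ‖v‖ = (ℓ₀ : ℝ) →
        (ℓ₀ : ℝ) ^ q * (1 + |reg.β k|) ^ q * cruxMoment Nf (reg.β k) (bareMass reg m k) S f v s ≤ 1

/-- The crux's consequent (clause (ii) of `MobilityGap`), verbatim up to the abbreviations above. -/
def Conclusion (Nf : ℕ) (reg : QCDRegularisation Nf) (m : Fin Nf → ℝ) : Prop :=
  ∃ s δ C : ℝ, 0 < s ∧ s < 1 ∧ 0 < δ ∧ ∀ᶠ k in atTop, ∀ S : ℕ, reg.L k ≤ S →
    ∀ (f : Fin Nf) (v : Literature.Probability.LatticeModels.Site 4), v ∈ box 4 S →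
      cruxMoment Nf (reg.β k) (bareMass reg m k) S f v s ≤ C * Real.exp (-(δ * (reg.a k * ‖v‖)))

/-- The crux is literally `K1 → K3 → ∀ Nf reg m > 0, Input → Conclusion` (definitional unfolding;
cf. the standing disprover's `fmClosure_iff`). -/
theorem crux_iff :
    Summit.QuantumFields.QCD.Theses.PauliWegnerSea.FMClosureUnquenched ↔
      (Summit.QuantumFields.QCD.Theses.PauliWegnerSea.FibreCofactorDomination →
        Summit.QuantumFields.QCD.Theses.PauliWegnerSea.TiltedFlatness →
          ∀ (Nf : ℕ) (reg : QCDRegularisation Nf) (m : Fin Nf → ℝ), (∀ f, 0 < m f) →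
            Input Nf reg m → Conclusion Nf reg m) :=
  Iff.rfl

/-! ## §1 Internal vocabulary (single-flavour Green functions, side-wise depletions, boxes; copied from the picked line) -/

/-- Quark index of ONE flavour on the torus of side `N`: site × colour × spin (the index type of the
tree's `wilsonDirac` for `SU(3)`). -/
abbrev QIdx (N : ℕ) : Type := TorusSite 4 N × Fin 3 × Fin 4

/-- `ℓ¹` block norm of the `(x,y)` colour–spin block of a one-flavour quark matrix:
`Σ_{a,i,b,j} |M_{(x,a,i),(y,b,j)}|` (the quantity under the power `s` in the crux). -/
def blockNorm {N : ℕ} (M : Matrix (QIdx N) (QIdx N) ℂ) (x y : TorusSite 4 N) : ℝ :=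
  ∑ a : Fin 3, ∑ i : Fin 4, ∑ b : Fin 3, ∑ j : Fin 4, ‖M (x, a, i) (y, b, j)‖

/-- The side matrix `M_A ⊕ 1` of a finite set `A` of sites: agrees with `M` between two sites of `A`
and is the identity elsewhere (ASFH's "turning off the hopping terms across `∂A`",
arXiv:math-ph/9910022 §2.a, in a form whose inverse never produces junk on the other side). -/
def sideMatrix {N : ℕ} [NeZero N] (A : Finset (TorusSite 4 N)) (M : Matrix (QIdx N) (QIdx N) ℂ) :
    Matrix (QIdx N) (QIdx N) ℂ :=
  Matrix.of fun p q => if p.1 ∈ A ∧ q.1 ∈ A then M p q else if p = q then 1 else 0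

/-- SIDE-WISE Dirichlet Green function of the site set `A` (ASFH's `G_Ω`, `Ω = A`): the inverse of
`sideMatrix A M`; its `A × A` blocks are those of `M_A⁻¹`. -/
def gside {N : ℕ} [NeZero N] (A : Finset (TorusSite 4 N)) (M : Matrix (QIdx N) (QIdx N) ℂ) :
    Matrix (QIdx N) (QIdx N) ℂ :=
  (sideMatrix A M)⁻¹

/-- The (odd, centred) sup-ball of radius `r` about `x` on the torus of side `2S+1`
(`z = x + w (mod 2S+1)`, `w ∈ {-r,…,r}⁴`; faithful for `r ≤ S`). Used only through its COMPLEMENT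
(forward steps): the inside of an odd ball is bipartite-unbalanced. -/
def ball (S : ℕ) (x : TorusSite 4 (2 * S + 1)) (r : ℕ) : Finset (TorusSite 4 (2 * S + 1)) :=
  (box 4 r).image fun w => x + Torus.proj (2 * S + 1) w

/-- The sup-sphere of radius `r` about `x` (inner boundary of the odd ball; the typed input lives on
the sphere of radius `ℓ₀` about `0`): offsets `w ∈ box r` with a coordinate equal to `±r`. -/
def sphere (S : ℕ) (x : TorusSite 4 (2 * S + 1)) (r : ℕ) : Finset (TorusSite 4 (2 * S + 1)) :=
  ((box 4 r).filter fun w : Literature.Probability.LatticeModels.Site 4 =>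
      ∃ i, w i = (r : ℤ) ∨ w i = -(r : ℤ)).image
    fun w => x + Torus.proj (2 * S + 1) w

/-- The EVEN box of "radius" `r` about `x`: offsets `w ∈ {-r-1,…,r}⁴` (side `2r+2`,
bipartite-balanced, so no parity obstruction to invertibility at any bare mass). The boxes
`W = ebox(x,ℓ)` and `Λ = ebox(x,3ℓ+2)` are the two depletion sets of the thick collar. -/
def ebox (S : ℕ) (x : TorusSite 4 (2 * S + 1)) (r : ℕ) : Finset (TorusSite 4 (2 * S + 1)) :=
  (Fintype.piFinset fun _ : Fin 4 => Finset.Icc (-(r : ℤ) - 1) r).image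
    fun w => x + Torus.proj (2 * S + 1) w

/-- Inner boundary of the even box of radius `r` about `x` (offsets with a coordinate in `{-r-1, r}`). -/
def boxIn (S : ℕ) (x : TorusSite 4 (2 * S + 1)) (r : ℕ) : Finset (TorusSite 4 (2 * S + 1)) :=
  ((Fintype.piFinset fun _ : Fin 4 => Finset.Icc (-(r : ℤ) - 1) r).filter
      fun w : Literature.Probability.LatticeModels.Site 4 =>
        ∃ i, w i = -(r : ℤ) - 1 ∨ w i = (r : ℤ)).image
    fun w => x + Torus.proj (2 * S + 1) w

/-- Outer boundary of the even box of radius `r` about `x` (offsets in `{-r-2,…,r+1}⁴` with a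
coordinate in `{-r-2, r+1}`). -/
def boxOut (S : ℕ) (x : TorusSite 4 (2 * S + 1)) (r : ℕ) : Finset (TorusSite 4 (2 * S + 1)) :=
  ((Fintype.piFinset fun _ : Fin 4 => Finset.Icc (-(r : ℤ) - 2) (r + 1)).filter
      fun w : Literature.Probability.LatticeModels.Site 4 =>
        ∃ i, w i = -(r : ℤ) - 2 ∨ w i = (r : ℤ) + 1).image
    fun w => x + Torus.proj (2 * S + 1) w

/-- The one-flavour Wilson–Dirac matrix (`r = 1`, fundamental `SU(3)`) at bare mass `m₀`. -/
def wilsonD {N : ℕ} [NeZero N] (U : GaugeConfig 4 N 𝔾) (m₀ : ℝ) : Matrix (QIdx N) (QIdx N) ℂ :=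
  wilsonDirac (fundamentalRep (Fin 3)) U m₀ 1

/-- Phase-quenched expectation `E_{|w|}[F] = ∫ ‖det D(U)‖ F(U) dμ_W(β) / ∫ ‖det D(U)‖ dμ_W(β)` on the
torus of side `2S+1`, with the MULTI-flavour weight `‖det diracMatrix U mq‖` of the crux (ratio of
Bochner integrals, same junk conventions as the crux; equals the tree's `qcdPhaseQuenchedExpect`). -/
def pqE (Nf S : ℕ) (β : ℝ) (mq : Fin Nf → ℝ)
    (F : GaugeConfig 4 (2 * S + 1) 𝔾 → ℝ) : ℝ :=
  (∫ U : GaugeConfig 4 (2 * S + 1) (Matrix.specialUnitaryGroup (Fin 3) ℂ),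
      ‖(diracMatrix U mq).det‖ * F U ∂(wilsonMeasure (fundamentalRep (Fin 3)) β)) /
    (∫ U : GaugeConfig 4 (2 * S + 1) (Matrix.specialUnitaryGroup (Fin 3) ℂ),
      ‖(diracMatrix U mq).det‖ ∂(wilsonMeasure (fundamentalRep (Fin 3)) β))

/-- The side sets the bootstrap depletes along: the whole torus, an even box, the complement of an
even box, the complement of an odd ball (radius `r ≥ 1`, `r + 1 ≤ S`, so that the ball, its cut
and the first exterior shell are faithful on the torus of side `2S+1`). Plain `Finset` equalities. -/
def AdmissibleSide (S : ℕ) (A : Finset (TorusSite 4 (2 * S + 1))) : Prop :=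
  A = Finset.univ ∨
    ∃ (x : TorusSite 4 (2 * S + 1)) (r : ℕ), 1 ≤ r ∧ r + 1 ≤ S ∧
      (A = ebox S x r ∨ A = (ebox S x r)ᶜ ∨ A = (ball S x r)ᶜ)

/-! ## §2 Packaged stub predicates of the picked line (verbatim, so that one registry serves both lines) -/

/-- **Two-star bounds** (card: "FibreLemmas" — K1 in local form, K3 for depleted determinants, the
fibre `R₂` decoupling; A7), stated in the AVERAGED forms the thick-collar bootstrap consumes, with one
constant `Ξ = C (1+|β|)^p (1+radius)^p` uniform in the volume `S`, the outside field (integrated, not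
frozen), the probe flavour's mass `m_f ∈ [-9,1]` and ALL other flavours' masses (they only tilt the
weight), for every `0 < s ≤ s₀`:
* (T0) the weight has positive mass and the (≤ 3)-fold products of `s`-powers of block norms of
  side-wise Green functions of admissible sides are integrable against it (no Bochner junk below);
* (Tinv) (reshape gen 1) every admissible side matrix `D_A ⊕ 1` of the probe flavour (and `D`, `A = univ`)
  is invertible `μ_W(β)`-almost everywhere (from `SideWitness` + the a.e. dichotomy (AE) of
  `FibreBandLaw`; needed because `Matrix.inv` is junk `0` at singular matrices and the resolvent
  bounds (Rfwd)/(R2) carry invertibility hypotheses);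
* (T5) a-priori bound `E‖G(x,y)‖^s ≤ C(1+|β|)^p` (ASFH Lemma 4);
* (Tdec) a DEPLETED factor living on one admissible side can be replaced by `Ξ_r` against one full
  Green-function factor (ASFH Lemma 6 / App. decoupling);
* (T1) spanning-factor removal: in the second-order identity the middle FULL factor `‖G(u',v)‖^s`
  between the two cuts (`u', v ∈ Λ ∖ W`, `W = ebox(x,ℓ)`, `Λ = ebox(x,3ℓ+2)`) can be replaced by
  `Ξ_ℓ` against the product of the inside factor `‖G_W(x,u)‖^s` and the far factor `‖G_{Λᶜ}(v',y)‖^s`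
  (ASFH Lemma 5, eq. (2.17), conditional form, here averaged).
Why averaged and not ess-sup: the ess-sup two-star conditional moment is NOT volume-uniform (tuned
in-window modes, rattack A7); under the measure such conspiracies cost probability. -/
def TwoStarBounds (Nf : ℕ) : Prop :=
  ∃ s₀ C p : ℝ, 0 < s₀ ∧ s₀ < 1 ∧ 0 < C ∧ ∀ s : ℝ, 0 < s → s ≤ s₀ →
  ∀ (β : ℝ) (mq : Fin Nf → ℝ) (f : Fin Nf), -9 ≤ mq f → mq f ≤ 1 → ∀ (S : ℕ),
    -- (T0) no junk: positive mass of the weight, integrability of the functionals used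
    (0 < ∫ U : GaugeConfig 4 (2 * S + 1) (Matrix.specialUnitaryGroup (Fin 3) ℂ),
        ‖(diracMatrix U mq).det‖ ∂(wilsonMeasure (fundamentalRep (Fin 3)) β)) ∧
    (∀ (s₁ s₂ s₃ : ℝ), 0 ≤ s₁ → s₁ ≤ s₀ → 0 ≤ s₂ → s₂ ≤ s₀ → 0 ≤ s₃ → s₃ ≤ s₀ →
      ∀ (A₁ A₂ A₃ : Finset (TorusSite 4 (2 * S + 1))),
        AdmissibleSide S A₁ → AdmissibleSide S A₂ → AdmissibleSide S A₃ →
      ∀ (a₁ b₁ a₂ b₂ a₃ b₃ : TorusSite 4 (2 * S + 1)),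
      Integrable (fun U : GaugeConfig 4 (2 * S + 1) (Matrix.specialUnitaryGroup (Fin 3) ℂ) =>
        ‖(diracMatrix U mq).det‖ *
          (blockNorm (gside A₁ (wilsonD U (mq f))) a₁ b₁ ^ s₁ *
            blockNorm (gside A₂ (wilsonD U (mq f))) a₂ b₂ ^ s₂ *
            blockNorm (gside A₃ (wilsonD U (mq f))) a₃ b₃ ^ s₃))
        (wilsonMeasure (fundamentalRep (Fin 3)) β)) ∧
    -- (Tinv) no junk, continued (RESHAPE gen 1): every admissible side matrix of the probe flavour —
    -- and `D` itself (`A = univ`) — is invertible for `μ_W(β)`-a.e. field (the resolvent identities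
    -- (Rfwd)/(R2) of `CollarResolventBounds` are stated under these invertibility hypotheses)
    (∀ (A : Finset (TorusSite 4 (2 * S + 1))), AdmissibleSide S A →
      ∀ᵐ U ∂(wilsonMeasure (fundamentalRep (Fin 3)) β), (sideMatrix A (wilsonD U (mq f))).det ≠ 0) ∧
    -- (T5) a-priori fractional-moment bound, uniform in the volume
    (∀ x y : TorusSite 4 (2 * S + 1),
      pqE Nf S β mq (fun U => blockNorm (wilsonD U (mq f))⁻¹ x y ^ s) ≤ C * (1 + |β|) ^ p) ∧
    -- (Tdec) a depleted factor on an admissible side is replaced by Ξ_r against a full factor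
    (∀ (x : TorusSite 4 (2 * S + 1)) (r : ℕ), 1 ≤ r → r + 1 ≤ S →
      ∀ (A : Finset (TorusSite 4 (2 * S + 1))),
        (A = ebox S x r ∨ A = (ebox S x r)ᶜ ∨ A = (ball S x r)ᶜ) →
      ∀ a b c d : TorusSite 4 (2 * S + 1), a ∈ A → b ∈ A →
        pqE Nf S β mq (fun U =>
            blockNorm (gside A (wilsonD U (mq f))) a b ^ s * blockNorm (wilsonD U (mq f))⁻¹ c d ^ s) ≤
          C * (1 + |β|) ^ p * (1 + (r : ℝ)) ^ p *
            pqE Nf S β mq (fun U => blockNorm (wilsonD U (mq f))⁻¹ c d ^ s)) ∧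
    -- (T1) spanning-factor removal between the two cuts of the thick collar
    (∀ (x : TorusSite 4 (2 * S + 1)) (ℓ : ℕ), 1 ≤ ℓ → 3 * ℓ + 4 ≤ S →
      ∀ u u' v v' y : TorusSite 4 (2 * S + 1),
        u' ∈ ebox S x (3 * ℓ + 2) → u' ∉ ebox S x ℓ → v ∈ ebox S x (3 * ℓ + 2) → v ∉ ebox S x ℓ →
        v' ∉ ebox S x (3 * ℓ + 2) → y ∉ ebox S x (3 * ℓ + 2) →
          pqE Nf S β mq (fun U =>
              blockNorm (gside (ebox S x ℓ) (wilsonD U (mq f))) x u ^ s *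
                blockNorm (wilsonD U (mq f))⁻¹ u' v ^ s *
                blockNorm (gside (ebox S x (3 * ℓ + 2))ᶜ (wilsonD U (mq f))) v' y ^ s) ≤
            C * (1 + |β|) ^ p * (1 + (ℓ : ℝ)) ^ p *
              pqE Nf S β mq (fun U =>
                blockNorm (gside (ebox S x ℓ) (wilsonD U (mq f))) x u ^ s *
                  blockNorm (gside (ebox S x (3 * ℓ + 2))ᶜ (wilsonD U (mq f))) v' y ^ s))

/-- **Far stability of the exit moment across a thick collar** — THE LOAD-BEARING STUB (card's
`ExitMomentFarStability`, sharpened by triage): for the inside factor `A = ‖G_W(x,u)‖^s`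
(`W = ebox(x,ℓ)`, measurable in the links of `W`) and the FAR factor the bootstrap actually
produces, `Ψ = ‖G_{Λᶜ}(v',y)‖^s` (`Λ = ebox(x,3ℓ+2)`, measurable in the links outside `Λ`),
separated by the integrated collar `Λ ∖ W` of width `> 2ℓ`:
`E[A Ψ] ≤ R · ((E A)^θ + E A) · E Ψ`, `R = C(1+|β|)^p(1+ℓ)^p`, some `θ ∈ (0,1]`,
uniformly in `S`, `y` (arbitrarily far), the masses as in `TwoStarBounds`, `0 < s ≤ s₀`.
Power form of the card's `∀ K ≥ 0: ≤ R(e^K E A + e^{-K/C}) E Ψ`, POLYNOMIAL in `1+|β|`, and for the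
SPECIFIC far functional (the ess-sup form is false at weak coupling). It replaces "the expectation
now factorizes" (ASFH p. 7) and is the only place where the non-product structure of
`ν = ‖det‖·μ_W` enters. -/
def FarStability (Nf : ℕ) : Prop :=
  ∃ s₀ C p θ : ℝ, 0 < s₀ ∧ s₀ < 1 ∧ 0 < C ∧ 0 < θ ∧ θ ≤ 1 ∧ ∀ s : ℝ, 0 < s → s ≤ s₀ →
  ∀ (β : ℝ) (mq : Fin Nf → ℝ) (f : Fin Nf), -9 ≤ mq f → mq f ≤ 1 →
  ∀ (S : ℕ) (x : TorusSite 4 (2 * S + 1)) (ℓ : ℕ), 1 ≤ ℓ → 3 * ℓ + 4 ≤ S →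
  ∀ u v' y : TorusSite 4 (2 * S + 1),
    u ∈ ebox S x ℓ → v' ∉ ebox S x (3 * ℓ + 2) → y ∉ ebox S x (3 * ℓ + 2) →
    pqE Nf S β mq (fun U =>
        blockNorm (gside (ebox S x ℓ) (wilsonD U (mq f))) x u ^ s *
          blockNorm (gside (ebox S x (3 * ℓ + 2))ᶜ (wilsonD U (mq f))) v' y ^ s) ≤
      C * (1 + |β|) ^ p * (1 + (ℓ : ℝ)) ^ p *
        (pqE Nf S β mq (fun U => blockNorm (gside (ebox S x ℓ) (wilsonD U (mq f))) x u ^ s) ^ θ +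
          pqE Nf S β mq (fun U => blockNorm (gside (ebox S x ℓ) (wilsonD U (mq f))) x u ^ s)) *
        pqE Nf S β mq (fun U =>
          blockNorm (gside (ebox S x (3 * ℓ + 2))ᶜ (wilsonD U (mq f))) v' y ^ s)

/-- **Collar resolvent bounds** (deterministic matrix algebra, configuration by configuration;
ASFH eqs. (2.11)–(2.16) in `ℓ¹`-block-norm form for the one-flavour Wilson–Dirac matrix with its
nearest-neighbour hops, `cT` = an absolute bound on the entries of one hop `½(1∓γ_μ)⊗U`).
REGISTERED IN UNFOLDED VOCABULARY: the `let`s below are, in order, `wilsonD U m₀`, `blockNorm`,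
`sideMatrix · (wilsonD U m₀)` (so `(side A)⁻¹ = gside A (wilsonD U m₀)`), `ball S x`, `sphere S x`,
`ebox S x`, `boxIn S x`, `boxOut S x` — definitionally. With `D = wilsonD U m₀`, `G = D⁻¹`, the side
matrices `N_A = D_A ⊕ 1` and their inverses:
* (Rfwd) `G = N⁻¹ + G (N - D) N⁻¹` for `N =` the side matrix of the COMPLEMENT of the odd ball
  `B(x,r)`, read at `(x,z)`, `z ∉ B(x,r)`: the entrance from the input sphere of radius `r` to any
  exterior point (support of `N - D` on rows of the ball: the cut hops `sphere r × sphere (r+1)`);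
* (Rin)  `N_W⁻¹ = G + G (D - N_W) N_W⁻¹` read at `(x,u)`, `u ∈ W = ebox(x,ℓ)` (reversed Lemma 6);
* (Rout) `N⁻¹ = G + N⁻¹ (D - N) G` for the complement side of `Λ = ebox(x,3ℓ+2)` read at `(v',y)`;
* (R2)   the second-order identity with `Γ₁ = Γ(W) ≠ Γ₂ = Γ(Λ)` read at `(x,y)`, `y ∉ Λ`
  ("the depletion sets need not coincide", p. 6): only the spanning diagram survives.
The invertibility hypotheses are genuine (`Matrix.inv` is junk `0` at singular matrices) and
concern only the sides actually inverted; where `D` itself is singular the bounded quantity is the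
junk `0` and the inequality is trivial. -/
def CollarResolventBounds : Prop :=
  ∃ cT : ℝ, 0 < cT ∧ ∀ (S : ℕ) (U : GaugeConfig 4 (2 * S + 1) (Matrix.specialUnitaryGroup (Fin 3) ℂ))
      (m₀ : ℝ) (x : TorusSite 4 (2 * S + 1)),
      let D : Matrix (TorusSite 4 (2 * S + 1) × Fin 3 × Fin 4) (TorusSite 4 (2 * S + 1) × Fin 3 × Fin 4) ℂ :=
        wilsonDirac (fundamentalRep (Fin 3)) U m₀ 1
      let bn : Matrix (TorusSite 4 (2 * S + 1) × Fin 3 × Fin 4) (TorusSite 4 (2 * S + 1) × Fin 3 × Fin 4) ℂ →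
          TorusSite 4 (2 * S + 1) → TorusSite 4 (2 * S + 1) → ℝ :=
        fun M y z => ∑ a : Fin 3, ∑ i : Fin 4, ∑ b : Fin 3, ∑ j : Fin 4, ‖M (y, a, i) (z, b, j)‖
      let side : Finset (TorusSite 4 (2 * S + 1)) →
          Matrix (TorusSite 4 (2 * S + 1) × Fin 3 × Fin 4) (TorusSite 4 (2 * S + 1) × Fin 3 × Fin 4) ℂ :=
        fun A => Matrix.of fun p q => if p.1 ∈ A ∧ q.1 ∈ A then D p q else if p = q then 1 else 0
      let ball : ℕ → Finset (TorusSite 4 (2 * S + 1)) := fun r =>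
        (box 4 r).image fun w => x + Torus.proj (2 * S + 1) w
      let sphere : ℕ → Finset (TorusSite 4 (2 * S + 1)) := fun r =>
        ((box 4 r).filter fun w : Literature.Probability.LatticeModels.Site 4 =>
            ∃ i, w i = (r : ℤ) ∨ w i = -(r : ℤ)).image
          fun w => x + Torus.proj (2 * S + 1) w
      let ebox : ℕ → Finset (TorusSite 4 (2 * S + 1)) := fun r =>
        (Fintype.piFinset fun _ : Fin 4 => Finset.Icc (-(r : ℤ) - 1) r).image
          fun w => x + Torus.proj (2 * S + 1) w
      let boxIn : ℕ → Finset (TorusSite 4 (2 * S + 1)) := fun r =>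
        ((Fintype.piFinset fun _ : Fin 4 => Finset.Icc (-(r : ℤ) - 1) r).filter
            fun w : Literature.Probability.LatticeModels.Site 4 =>
              ∃ i, w i = -(r : ℤ) - 1 ∨ w i = (r : ℤ)).image
          fun w => x + Torus.proj (2 * S + 1) w
      let boxOut : ℕ → Finset (TorusSite 4 (2 * S + 1)) := fun r =>
        ((Fintype.piFinset fun _ : Fin 4 => Finset.Icc (-(r : ℤ) - 2) (r + 1)).filter
            fun w : Literature.Probability.LatticeModels.Site 4 =>
              ∃ i, w i = -(r : ℤ) - 2 ∨ w i = (r : ℤ) + 1).image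
          fun w => x + Torus.proj (2 * S + 1) w
      (∀ r : ℕ, 1 ≤ r → r + 1 ≤ S → ∀ z : TorusSite 4 (2 * S + 1), z ∉ ball r →
        (side ((ball r)ᶜ)).det ≠ 0 →
          bn D⁻¹ x z ≤
            cT * ∑ p ∈ sphere r, ∑ p' ∈ sphere (r + 1), bn D⁻¹ x p * bn (side ((ball r)ᶜ))⁻¹ p' z) ∧
      ∀ ℓ : ℕ, 1 ≤ ℓ → ℓ + 2 ≤ S →
        (∀ u : TorusSite 4 (2 * S + 1), u ∈ ebox ℓ → D.det ≠ 0 →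
          bn (side (ebox ℓ))⁻¹ x u ≤
            bn D⁻¹ x u +
              cT * ∑ w' ∈ boxOut ℓ, ∑ w ∈ boxIn ℓ, bn D⁻¹ x w' * bn (side (ebox ℓ))⁻¹ w u) ∧
        (3 * ℓ + 4 ≤ S →
          (∀ v' y : TorusSite 4 (2 * S + 1), v' ∉ ebox (3 * ℓ + 2) → y ∉ ebox (3 * ℓ + 2) →
            D.det ≠ 0 →
              bn (side ((ebox (3 * ℓ + 2))ᶜ))⁻¹ v' y ≤
                bn D⁻¹ v' y +
                  cT * ∑ w' ∈ boxOut (3 * ℓ + 2), ∑ w ∈ boxIn (3 * ℓ + 2),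
                    bn (side ((ebox (3 * ℓ + 2))ᶜ))⁻¹ v' w' * bn D⁻¹ w y) ∧
          (∀ y : TorusSite 4 (2 * S + 1), y ∉ ebox (3 * ℓ + 2) →
            (side (ebox ℓ)).det ≠ 0 → (side ((ebox (3 * ℓ + 2))ᶜ)).det ≠ 0 →
              bn D⁻¹ x y ≤
                cT ^ 2 * ∑ u ∈ boxIn ℓ, ∑ u' ∈ boxOut ℓ,
                  ∑ v ∈ boxIn (3 * ℓ + 2), ∑ v' ∈ boxOut (3 * ℓ + 2),
                    bn (side (ebox ℓ))⁻¹ x u * bn D⁻¹ u' v *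
                      bn (side ((ebox (3 * ℓ + 2))ᶜ))⁻¹ v' y))

/-- **Unit-shell lower bound** (the refuters' A5 corner `ℓ₀ = 1`, `β_k → 0`, made vacuous; card §(vi),
toy j006913: at `β = 0` the quenched `E log Σ|G(0,e_μ)|` is `+0.22` at `κ = 1/8` and crosses `0` only at
`κ* ≈ 0.113`, i.e. `m₀ ≈ 0.42`): there are `β₀ > 0` and `S₀` such that for `|β| ≤ β₀`, probe mass in the
non-hopping window `m_f ∈ [-8.1, 0.1]` (other masses arbitrary), side `≥ 2S₀+1` and EVERY `s ∈ (0,1)`,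
some unit-shell vector `v` (`‖v‖∞ = 1`) has phase-quenched moment `> 1` — so the typed input
`1^q (1+|β|)^q E ≤ 1` cannot hold at `ℓ₀ = 1` there. By Jensen it suffices that
`E_{|w|} log Σ|G_f(0,v)| > 0`; margins are thin near `m_f = 0.1`. -/
def UnitShellLowerBound (Nf : ℕ) : Prop :=
  ∃ β₀ : ℝ, 0 < β₀ ∧ ∃ S₀ : ℕ, ∀ β : ℝ, |β| ≤ β₀ → ∀ (mq : Fin Nf → ℝ) (f : Fin Nf),
    -(81 / 10 : ℝ) ≤ mq f → mq f ≤ 1 / 10 → ∀ S : ℕ, S₀ ≤ S → ∀ s : ℝ, 0 < s → s < 1 →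
      ∃ v : Literature.Probability.LatticeModels.Site 4, v ∈ box 4 S ∧ ‖v‖ = (1 : ℝ) ∧
        1 < cruxMoment Nf β mq S f v s

/-- **Hopping decay** (heavy and negative-heavy probe mass `|m_f + 4| ≥ 4.1`, every `β`, every
background; provable now): `wilsonDirac U m₀ 1 = (m₀+4)·1 - Σ_μ W_μ` with `‖W_μ‖₂ ≤ 1`
(tree `wilsonDirac_eq_sub_sum_wilsonHop`, `l2_opNorm_wilsonHop_le`), so
`HoppingExpansionLocality_holds` (`isHoppingNorm_l2OpNorm`) gives
`|G_{xy}| ≤ θ^{dist}/((1-θ)|m₀+4|)`, `θ = 4/4.1`, configuration-wise; integrate the `s`-th power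
against the normalised phase-quenched weight (torus distance `≥ ‖v‖∞` for `v ∈ box S`; the heavy
positive-mass half is the tree's `phaseQuenched_fractionalMoment_decay_of_heavy` pattern).
REGISTERED IN UNFOLDED VOCABULARY: the quotient below is `cruxMoment Nf β mq S f v s` verbatim. -/
def HoppingDecay (Nf : ℕ) : Prop :=
  ∃ C μ : ℝ, 0 ≤ C ∧ 0 < μ ∧ ∀ (β : ℝ) (mq : Fin Nf → ℝ) (f : Fin Nf), (41 / 10 : ℝ) ≤ |mq f + 4| →
      ∀ (S : ℕ) (s : ℝ), 0 < s → s < 1 →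
        ∀ v : Literature.Probability.LatticeModels.Site 4, v ∈ box 4 S →
          (∫ U : GaugeConfig 4 (2 * S + 1) (Matrix.specialUnitaryGroup (Fin 3) ℂ),
              ‖(diracMatrix U mq).det‖ *
                (∑ a : Fin 3, ∑ i : Fin 4, ∑ b : Fin 3, ∑ j : Fin 4,
                  ‖(diracMatrix U mq)⁻¹ (quarkEquiv (f, (Torus.proj (2 * S + 1) 0, a, i)))
                    (quarkEquiv (f, (Torus.proj (2 * S + 1) (v), b, j)))‖) ^ s
              ∂(wilsonMeasure (fundamentalRep (Fin 3)) β)) /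
            (∫ U : GaugeConfig 4 (2 * S + 1) (Matrix.specialUnitaryGroup (Fin 3) ℂ),
              ‖(diracMatrix U mq).det‖ ∂(wilsonMeasure (fundamentalRep (Fin 3)) β)) ≤
          C * Real.exp (-(μ * s * ‖v‖))

/-- Outward decay package produced by the bootstrap: decay at physical rate `δ a_k` for
`‖v‖∞ ≥ ℓ₀(k,f)`, k-uniform constant, with the outward radius inside the log-scale window
`ℓ₀(k,f) a_k ≤ K₀(1+|log a_k|)` of the typed input AND inside the torus, `ℓ₀(k,f) ≤ L_k` (reshape (iv);
`ℓ₀(k,f) = 0` on steps/flavours where the closure already has decay everywhere, e.g. the hopping window). -/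
def OutwardDecayWith (Nf : ℕ) (reg : QCDRegularisation Nf) (m : Fin Nf → ℝ)
    (s δ C K₀ : ℝ) (ℓ₀ : ℕ → Fin Nf → ℕ) : Prop :=
  0 < s ∧ s < 1 ∧ 0 < δ ∧ 0 ≤ C ∧
  (∀ᶠ k in atTop, ∀ f : Fin Nf, (ℓ₀ k f : ℝ) * reg.a k ≤ K₀ * (1 + |Real.log (reg.a k)|)) ∧
  (∀ᶠ k in atTop, ∀ f : Fin Nf, ℓ₀ k f ≤ reg.L k) ∧
  ∀ᶠ k in atTop, ∀ S : ℕ, reg.L k ≤ S →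
    ∀ (f : Fin Nf) (v : Literature.Probability.LatticeModels.Site 4), v ∈ box 4 S → (ℓ₀ k f : ℝ) ≤ ‖v‖ →
      cruxMoment Nf (reg.β k) (bareMass reg m k) S f v s ≤ C * Real.exp (-(δ * (reg.a k * ‖v‖)))

/-- Inward decay package: the complementary region `‖v‖∞ < ℓ₀(k,f)` at the SAME exponent `s`. -/
def InwardDecayWith (Nf : ℕ) (reg : QCDRegularisation Nf) (m : Fin Nf → ℝ)
    (s δ' C' : ℝ) (ℓ₀ : ℕ → Fin Nf → ℕ) : Prop :=
  0 < δ' ∧ 0 ≤ C' ∧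
  ∀ᶠ k in atTop, ∀ S : ℕ, reg.L k ≤ S →
    ∀ (f : Fin Nf) (v : Literature.Probability.LatticeModels.Site 4), v ∈ box 4 S → ‖v‖ < (ℓ₀ k f : ℝ) →
      cruxMoment Nf (reg.β k) (bareMass reg m k) S f v s ≤ C' * Real.exp (-(δ' * (reg.a k * ‖v‖)))

/-- **Inward extension** (refuters' A6 = BarrierNotes B0 + the k-uniform short-distance bound A7;
NOT this idea's mechanism — the complementary half every outward line must carry): given the
two-star bounds, the typed input and the outward package, decay holds inside the outward radius
too. Mechanism known only on the even-`N_f`, pairwise-degenerate, `m_f > -1` locus (Lüscher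
transfer-matrix positivity in the antiperiodic auxiliary theory); OPEN for odd `N_f` — if it dies,
the crux is restated to `‖v‖∞ ≥ ℓ₀(k)` (A6 repair) and this stub disappears. -/
def InwardExtension (Nf : ℕ) (reg : QCDRegularisation Nf) (m : Fin Nf → ℝ) : Prop :=
  TwoStarBounds Nf → Input Nf reg m →
    ∀ (s δ C K₀ : ℝ) (ℓ₀ : ℕ → Fin Nf → ℕ), OutwardDecayWith Nf reg m s δ C K₀ ℓ₀ →
      ∃ δ' C' : ℝ, InwardDecayWith Nf reg m s δ' C' ℓ₀

/-! ## §3 This line's content: circle laws, fibre band laws, uniform cofactor domination -/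

/-- Trigonometric polynomial of degree `≤ d`: `f θ = Σ_{k=-d}^{d} c_k e^{ikθ}` (complex-valued function
of a real angle; real ones are those with `c_{-k} = conj c_k`). -/
def IsTrigPoly (d : ℕ) (f : ℝ → ℂ) : Prop :=
  ∃ c : ℤ → ℂ, ∀ θ : ℝ,
    f θ = ∑ k ∈ Finset.Icc (-(d : ℤ)) d, c k * Complex.exp ((k : ℂ) * (θ : ℂ) * Complex.I)

/-- Mean of `g` against a non-negative circle weight `w` over one period `[0, 2π]`
(ratio of interval integrals; the laws below are `∝ w(θ) dθ`). -/
def circleMean (w : ℝ → ℝ) (g : ℝ → ℝ) : ℝ :=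
  (∫ θ in (0 : ℝ)..(2 * Real.pi), g θ * w θ) / (∫ θ in (0 : ℝ)..(2 * Real.pi), w θ)

/-- **Circle law** for the degrees `(d, dJ, dh)` — the ONE-VARIABLE lever of the line.  For every
circle law `∝ e^{h(θ)} |J(θ)| dθ` with `h` a REAL trigonometric polynomial of degree `≤ dh` and
`|h| ≤ κ` (the Wilson action along a one-link circle: `dh = 2`, `κ ≤ c₁|β|` with `c₁` absolute — only the `≤ 6` plaquettes through the link move; a first harmonic — von
Mises — when `L ≥ 2`) and `J ≢ 0` a trigonometric polynomial of degree `≤ dJ` (the tilt `|P|` seen along the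
circle — no Jacobian ever appears: the iteration is coordinate-free), and for every trigonometric
polynomial `Q` of degree `≤ d`:
* (Flat) `‖Q θ₀‖ ≤ C (1+κ)^p · mean_w ‖Q‖` for every `θ₀` — the law cannot hide the bulk of a
  band-limited function (arc Remez: the law carries mass `≥ c κ^{-1/2}` on an arc of length `κ^{-1/2}`
  around `argmax (h + log|J|)`, on which its density is within a constant factor of its maximum;
  Remez/Nikolskii for trigonometric polynomials on that arc);
* (Neg) for `0 < s ≤ s₀` (`s₀ < 1/(2d)`): `‖Q‖^{-s} w` is integrable over the period and
  `mean_w ‖Q‖^{-s} ≤ C (1+κ)^p (sup ‖Q‖)^{-s}` — relative small balls in negative-moment form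
  (the density of the law w.r.t. `dθ` is `≤ C κ^{1/2+dJ}`, and the Lebesgue sublevel bound
  `|{θ : |Q θ| ≤ t sup|Q|}| ≤ C(d) t^{1/(2d)}` of Turán–Nazarov / Remez type; a zero of a degree-`d`
  trigonometric polynomial has order `≤ 2d`).
Constants depend on `(d, dJ, dh)` only — uniform in `κ ≥ 0`, in the coefficients and in the position
of the zeros (both sides scale alike under concentration: triage r1-1 App. B ran the worst cases,
ratio `≤ 33` at `d = 4` up to `κ = 10⁶`).  Degenerate `Q ≡ 0` is harmless (`0 ≤ 0` by the junk value
`0^{-s} = 0`). -/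
def CircleLaw (d dJ dh : ℕ) : Prop :=
  ∃ s₀ C p : ℝ, 0 < s₀ ∧ 0 < C ∧ ∀ (κ : ℝ) (h : ℝ → ℝ) (J Q : ℝ → ℂ),
    0 ≤ κ → IsTrigPoly dh (fun θ => (h θ : ℂ)) → (∀ θ, |h θ| ≤ κ) →
    IsTrigPoly dJ J → (∃ θ, J θ ≠ 0) → IsTrigPoly d Q →
      let w : ℝ → ℝ := fun θ => Real.exp (h θ) * ‖J θ‖
      (∀ θ₀ : ℝ, ‖Q θ₀‖ ≤ C * (1 + κ) ^ p * circleMean w (fun θ => ‖Q θ‖)) ∧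
      (∀ s : ℝ, 0 < s → s ≤ s₀ →
        IntervalIntegrable (fun θ => ‖Q θ‖ ^ (-s) * w θ) volume 0 (2 * Real.pi) ∧
        circleMean w (fun θ => ‖Q θ‖ ^ (-s)) ≤ C * (1 + κ) ^ p * (⨆ θ : ℝ, ‖Q θ‖) ^ (-s))

/-- A function of the gauge field is a **fibre polynomial of degree `≤ d`**: continuous, and a
trigonometric polynomial of degree `≤ d` along every one-link CONJUGATE-CIRCLE ORBIT
`θ ↦ W[e ↦ W_e · V T(θ) V⁻¹ · B]`, where `T(θ) = diag(e^{iθ}, e^{-iθ}, 1)` is the diagonal circle of the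
route's `PauliBandLimit` (quantified, as there, through its matrix), `V` ranges over `SU(3)` (the four
circle letters `P₀₁, R₀₁, P₁₂, R₁₂` of `Theorems/…Su3CircleWord.lean` are such conjugates, and so is every
letter seen from a translated base point) and `B` is any fixed right factor.
Members, degree `4` per flavour (`stub_twoStar` proves it where it uses it): `det` and every adjugate
entry of the one-flavour Wilson–Dirac matrix and of each of its side matrices `D_A ⊕ 1` — the
`e^{±iθ}`-coefficients of the link `W_e V T(θ) V⁻¹ B` have rank one, so those of `D` have rank `≤ 4`
(`PauliBandLimit`, LANDED as `Theorems/PauliWegnerSeaPauliBandLimit.lean` with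
`det_add_smul_add_smul_of_rank_le`; restriction to `A` and deletion of a row and a column do not raise
ranks) — hence `det diracMatrix` (degree `4 N_f`) and all products of these. -/
def IsFibrePoly {N : ℕ} (d : ℕ) (F : GaugeConfig 4 N 𝔾 → ℂ) : Prop :=
  Continuous F ∧ ∀ (W : GaugeConfig 4 N 𝔾) (e : Edge 4 N) (V B : 𝔾) (T : ℝ → 𝔾),
    (∀ θ : ℝ, ((T θ : 𝔾) : Matrix (Fin 3) (Fin 3) ℂ) =
        Matrix.diagonal ![Complex.exp (θ * Complex.I), Complex.exp (-(θ * Complex.I)), 1]) →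
      IsTrigPoly d (fun θ => F (Function.update W e (W e * (V * T θ * V⁻¹) * B)))

/-! ### Bridges to the landed band limit (sorry-free; templates for the `IsFibrePoly` obligations of stub 3) -/

/-- The `Fin 9`-indexed Laurent form in which the route's `PauliBandLimit` is stated is an
`IsTrigPoly 4` (reindex `k ↦ k - 4`). -/
theorem isTrigPoly_four_of_fin_nine {f : ℝ → ℂ} (c : Fin 9 → ℂ)
    (hf : ∀ θ : ℝ, f θ = ∑ k : Fin 9, c k * Complex.exp ((((k : ℕ) : ℝ) - 4 : ℝ) * θ * Complex.I)) :
    IsTrigPoly 4 f := by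
  classical
  refine ⟨fun k => if h : 0 ≤ k + 4 ∧ k + 4 < 9 then c ⟨(k + 4).toNat, by omega⟩ else 0, fun θ => ?_⟩
  rw [hf θ]
  symm
  refine Finset.sum_bij (fun (k : ℤ) (hk : k ∈ Finset.Icc (-(4 : ℤ)) 4) =>
      (⟨(k + 4).toNat, by rw [Finset.mem_Icc] at hk; omega⟩ : Fin 9)) ?_ ?_ ?_ ?_
  · intro k hk
    exact Finset.mem_univ _
  · intro k₁ hk₁ k₂ hk₂ h
    rw [Finset.mem_Icc] at hk₁ hk₂
    have := congrArg Fin.val h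
    simp only at this
    omega
  · intro b _
    refine ⟨(b : ℤ) - 4, ?_, ?_⟩
    · rw [Finset.mem_Icc]; omega
    · apply Fin.ext
      simp only
      omega
  · intro k hk
    rw [Finset.mem_Icc] at hk
    have h9 : 0 ≤ k + 4 ∧ k + 4 < 9 := by omega
    simp only [dif_pos h9]
    congr 1
    congr 1
    have hcast : (((k + 4).toNat : ℕ) : ℝ) - 4 = (k : ℝ) := by
      have : ((k + 4).toNat : ℤ) = k + 4 := Int.toNat_of_nonneg h9.1
      have : (((k + 4).toNat : ℕ) : ℝ) = ((k + 4 : ℤ) : ℝ) := by exact_mod_cast this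
      rw [this]; push_cast; ring
    rw [show ((((k + 4).toNat : ℕ) : ℝ) - 4 : ℝ) = (k : ℝ) from hcast]
    push_cast
    ring

/-- The LANDED `PauliBandLimit_proof` (item 11514) feeds the definition: along the diagonal circle
`θ ↦ U[e ↦ U_e T(θ)]` the one-flavour Wilson determinant is `IsTrigPoly 4` — the `V = B = 1` case of
the orbit condition in `IsFibrePoly 4` for `W ↦ det (wilsonD W m₀)`.  Stub 3 extends this to
conjugates `V T V⁻¹`, right factors `B`, side matrices and adjugate entries by the same rank
argument (`det_add_smul_add_smul_of_rank_le`). -/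
theorem isTrigPoly_det_wilsonDirac_circle (L : ℕ) [NeZero L] (U : GaugeConfig 4 L 𝔾) (m₀ : ℝ)
    (e : Edge 4 L) (T : ℝ → 𝔾)
    (hT : ∀ θ : ℝ, ((T θ : 𝔾) : Matrix (Fin 3) (Fin 3) ℂ) =
      Matrix.diagonal ![Complex.exp (θ * Complex.I), Complex.exp (-(θ * Complex.I)), 1]) :
    IsTrigPoly 4 (fun θ => (wilsonDirac (fundamentalRep (Fin 3)) (Function.update U e (U e * T θ)) m₀ 1).det) := by
  obtain ⟨c, hc⟩ := _root_.Summit.QuantumFields.QCD.Theorems.PauliBandLimit_proof L U m₀ e T hT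
  exact isTrigPoly_four_of_fin_nine c hc

/-- **Fibre band law** — the iteration's output, = `TiltedFlatness` (a) + (b′) in negative-moment form
for EVERY fibre polynomial, every `β ∈ ℝ`, every tilt.  For all `n, d` there are `s₀, C, p > 0` such
that on every torus, for every link set `R` with `≤ n` links, every outside field `U`, every `β ∈ ℝ` and
all fibre polynomials `P` (the tilt; `P ≢ 0` on the fibre) and `Q` of degree `≤ d`, writing `refit W`
for `U` with the links of `R` replaced by those of `W`, `wt = e^{-β S_W(refit W)} ‖P(refit W)‖`,
`haar` = product Haar, `Z = ∫ wt`: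
* (AE) if `Q ≢ 0` on the fibre then `Q(refit W) ≠ 0` for `haar`-a.e. `W` — the qualitative band law (LANDED
  machinery: `stub_trigDichotomy` + `stub_haarCurveStep` + `stub_haarWordIterate` + `stub_su3CircleWord` of the
  `GluonicCompletion` line `finite-sign-budget-at-the-scheme-volume`, there run for `det`; it makes the junk value
  `0^{-s} = 0` of `Real.rpow` at the zeros of `Q` invisible to every consumer's Markov / Hölder step);
* (Flat) `‖Q(refit W₀)‖ ≤ C (1+|β|)^p ∫ ‖Q∘refit‖ wt / Z` for every `W₀`;
* (Neg) for `0 < s ≤ s₀`: `‖Q∘refit‖^{-s} wt` is `haar`-integrable and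
  `∫ ‖Q∘refit‖^{-s} wt / Z ≤ C (1+|β|)^p (sup_W ‖Q(refit W)‖)^{-s}`.
Why plausibly true: the conditional law of one letter angle given everything else is a circle law of
`CircleLaw (d, d, 2)` type (`h` = `-β ×` the `≤ 6` plaquettes through the link, a trigonometric
polynomial of degree `≤ 2` in the letter angle with `|h - const| ≤ c₁|β|`, `c₁` absolute; `J` = `P` along the orbit);
iterate over the `9 · #R` letters of a surjective word (LANDED `stub_su3CircleWord`), pushing
`(sup_θ ‖Q‖)^{-s} = inf_θ ‖Q‖^{-s}` resp. `sup_θ ‖Q‖` through the next conditional expectation in the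
monotone direction; right-invariance of Haar under each letter subgroup makes the coset bookkeeping exact
(LANDED `stub_haarCurveStep` is the same step for sets).  Constants `(C (1+c₁|β|)^p)^{9n}`. -/
def FibreBandLaw : Prop :=
  ∀ n d : ℕ, ∃ s₀ C p : ℝ, 0 < s₀ ∧ 0 < C ∧ ∀ (N : ℕ) [NeZero N] (R : Finset (Edge 4 N)), R.card ≤ n →
    ∀ (U : GaugeConfig 4 N 𝔾) (β : ℝ) (P Q : GaugeConfig 4 N 𝔾 → ℂ), IsFibrePoly d P → IsFibrePoly d Q →
      let refit : GaugeConfig 4 N 𝔾 → GaugeConfig 4 N 𝔾 := fun W e => if e ∈ R then W e else U e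
      let wt : GaugeConfig 4 N 𝔾 → ℝ := fun W =>
        Real.exp (-(β * wilsonAction (fundamentalRep (Fin 3)) (refit W))) * ‖P (refit W)‖
      let haar : Measure (GaugeConfig 4 N 𝔾) := Measure.pi fun _ => haarProbability 𝔾
      let Z : ℝ := ∫ W, wt W ∂haar
      (∃ W, P (refit W) ≠ 0) →
        ((∃ W, Q (refit W) ≠ 0) → ∀ᵐ W ∂haar, Q (refit W) ≠ 0) ∧
        (∀ W₀ : GaugeConfig 4 N 𝔾,
          ‖Q (refit W₀)‖ ≤ C * (1 + |β|) ^ p * ((∫ W, ‖Q (refit W)‖ * wt W ∂haar) / Z)) ∧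
        (∀ s : ℝ, 0 < s → s ≤ s₀ →
          Integrable (fun W => ‖Q (refit W)‖ ^ (-s) * wt W) haar ∧
          (∫ W, ‖Q (refit W)‖ ^ (-s) * wt W ∂haar) / Z ≤
            C * (1 + |β|) ^ p * (⨆ W : GaugeConfig 4 N 𝔾, ‖Q (refit W)‖) ^ (-s))

/-- **Local (uniform) cofactor domination, K1♭** — the deterministic core of `stub_twoStar`; NOT this
idea's mechanism (circles average, they do not count), named here because it is what every outward line
consumes and what K1 AS TYPED does not give (LEAD-c1 point 1).  ONE constant `C₀` such that for every
probe mass `m₀ ∈ [-9, 1]` (the complement of the landed hopping window `|m₀ + 4| ≥ 4.1` is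
`(-8.1, 0.1)`; outside it the bound is trivial by the Neumann series), every odd torus, every background,
every admissible side `A` (whole torus, even box, complement of an even box or of an odd ball — the
bipartite-unbalanced insides of odd balls are excluded, as in the picked line) and all `x, y ∈ A`
(diagonal INCLUDED: one star), on the fibre of the links of `star(x) ∪ star(y)`:
`sup_fibre Σ_{a i b j} ‖adj(D_A ⊕ 1)_{(x,a,i),(y,b,j)}‖ ≤ C₀ · sup_fibre ‖det(D_A ⊕ 1)‖`.
This is the lead's `K2Repaired.FibreCofactorDominationUniform` (K1 with `(1 + n_w)` deleted and `∃ C₀`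
leading) extended to side matrices, to `x = y` and to the doubler masses; mechanism = K1's
(γ₅-hermiticity is site-local, so `D_A` is γ₅-hermitian too: `adj = det · G` is pole-free and every pole
of `G_A` carries the same `H_A`-eigenvector at both ends; two stars shake every mode cored at `x` or
`y`).  Why it might fail: exactly K1's risk without the `n_w` allowance — hybridised clusters of
near-real modes of `H_A` cored between `x` and `y`, or a `W`-independent kernel on a whole two-star
fibre with `adj_xy ≢ 0`; the card's numerics (two-star ratio `≤ 1.42` with up to 8 in-window modes,
kit j002311/j002312) saw no growth with the mode count, but only on `m₀ ∈ [-1.5, 0.3]`, `d = 2, 4`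
small volumes.  Cheapest falsifier: the route's NEXT-cheapest test (6⁴–8⁴, 20–60 in-window modes)
WITHOUT the `n_w` allowance, plus the even-box side matrices at `m₀ = -4`. -/
def LocalCofactorDomination : Prop :=
  ∃ C₀ : ℝ, 0 < C₀ ∧ ∀ (m₀ : ℝ), -9 ≤ m₀ → m₀ ≤ 1 →
    ∀ (S : ℕ) (U : GaugeConfig 4 (2 * S + 1) 𝔾) (A : Finset (TorusSite 4 (2 * S + 1))),
      AdmissibleSide S A → ∀ (x y : TorusSite 4 (2 * S + 1)), x ∈ A → y ∈ A →
        let star : Edge 4 (2 * S + 1) → Prop := fun e =>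
          e.1 = x ∨ Site.shift e.1 e.2 = x ∨ e.1 = y ∨ Site.shift e.1 e.2 = y
        let refit : GaugeConfig 4 (2 * S + 1) 𝔾 → GaugeConfig 4 (2 * S + 1) 𝔾 :=
          fun W e => if star e then W e else U e
        ∀ W : GaugeConfig 4 (2 * S + 1) 𝔾, ∃ W' : GaugeConfig 4 (2 * S + 1) 𝔾,
          blockNorm ((sideMatrix A (wilsonD (refit W) m₀)).adjugate) x y ≤
            C₀ * ‖(sideMatrix A (wilsonD (refit W') m₀)).det‖

/-- **Side-matrix witnesses** (RESHAPE gen 1; deterministic, the second half of `stub_deterministic`):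
for every probe mass `m₀ ∈ [-9, 1]`, every odd torus and every admissible side `A` (the whole torus, an
even box, the complement of an even box or of an odd ball) there is ONE gauge field at which the side
matrix `D_A ⊕ 1` of the one-flavour Wilson–Dirac matrix is invertible.  With the a.e. dichotomy for
fibre polynomials ((AE) of `FibreBandLaw`: `≢ 0 ⇒ ≠ 0` Haar-a.e., the landed circle-word machinery of
`Theorems/PauliWegnerSeaGluonicCompletionDetNonvanishing.lean`) it gives (Tinv) of `TwoStarBounds`.
Known: `A = univ` for EVERY real mass (constant diagonal twist, landed
`Literature/…/QuantumLattice/TwistedFreeWilsonDirac.lean`); even boxes / complements: by the numerical-range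
bound `Re (D_A ⊕ 1) ≥ m₀ + Σ_μ (1 - cos (π/(L_μ+1)))` trivially for `m₀ ≥ 0` and `m₀ ≤ -8`, OPEN in
`(-8, 0)` (no universal real eigenvalue of the Dirichlet hopping matrix `K_A(U)` over `U ∈ SU(3)^E`;
even boxes avoid the bipartite obstruction of odd balls at `m₀ = -4`, toy `evenbox-parity-toy.txt`).
Why it might fail: a universal eigenvalue `m₀ + 4 ∈ ⋂_U spec K_A(U)` for some even box — then the
two-cut identity (R2) is void at that mass and the bootstrap needs another depletion radius. -/
def SideWitness : Prop :=
  ∀ (m₀ : ℝ), -9 ≤ m₀ → m₀ ≤ 1 →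
    ∀ (S : ℕ) (A : Finset (TorusSite 4 (2 * S + 1))), AdmissibleSide S A →
      ∃ U : GaugeConfig 4 (2 * S + 1) 𝔾, (sideMatrix A (wilsonD U m₀)).det ≠ 0

/-! ## §4 Registered stubs -/

/-- **stub 1a — the circle law (M; THE LEVER; one-variable real analysis over the landed
`Literature.Analysis.Fourier.trigPoly_nikolskii` / `trigPoly_smallBall`; held by the lead).**
`∀ d dJ dh, CircleLaw d dJ dh` (RESHAPE gen 1: split from the iteration `stub_fibreBandLaw` below).
CIRCLE LAW, proof plan: (i) Lebesgue sublevel bound for trigonometric polynomials of degree `≤ d` on the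
period, `|{|Q| ≤ t · sup|Q|}| ≤ C(d) t^{1/(2d)}` (Turán–Nazarov lemma / Remez inequality for
trigonometric polynomials, Borwein–Erdélyi GTM 161 §5.1 E.17–E.19, Nazarov 1993; or via `t = tan(θ/2)`
from the algebraic Remez inequality on three arcs); (ii) density of the law `e^{h}|J|/Z ≤ C κ^{1/2+dJ}`
(mass of the arc `|θ - argmax h| ≤ κ^{-1/2}`: `h ≥ max h - C(dh)` there since `‖h''‖ ≤ C(dh) κ`; Remez
for `J` on that arc); (iii) layer cake ⇒ (Neg) for `s < 1/(2d)`; (iv) (Flat) by the same arc +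
Nikolskii on the arc + the 1-D product-sup inequality `sup|QJ| ≥ c(d,dJ) sup|Q| sup|J|` (compactness of
the unit spheres of the two coefficient spaces).  Numerically certified worst cases: triage r1-1 App. B
(ratio `≤ 33` at `d = 4`, `s → 1/8`, `κ ≤ 10⁶`).
FIBRE BAND LAW from the circle law, proof plan (all `β ∈ ℝ`, no `2 ≤ L`): with `G` the gauge-field group
(pointwise), `μ` = product Haar (right-invariant; usage pattern LANDED in
`Theorems/PauliWegnerSeaGluonicCompletionDetNonvanishing.lean`) and a letter `c = δ_e ∘ L_j`
(`L_j ∈ {P₀₁, R₀₁, P₁₂, R₁₂}`, each a conjugate `V_j T V_j⁻¹` of the diagonal circle, a `2π`-periodic one-parameter subgroup):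
(1) coset formula `∫ F dμ = ∫ (⨍ F(g·c(θ)) dθ) dμ(g)` (Fubini + `integral_mul_right_eq_self`);
(2) the conditional law on the orbit through `g` is `∝ e^{h_g(θ)} |P(g·c(θ))| dθ` with
`h_g(θ) = -β (S_W(g·c θ) - S_W(g))` a real trigonometric polynomial of degree `≤ 2` with
`|h_g| ≤ c₁|β|` (only the `≤ 6` plaquettes through `e` move; `c₁` absolute) and `θ ↦ P(g·c θ)`, `θ ↦ Q(g·c θ)`
trigonometric of degree `≤ d` (`IsFibrePoly`: seen from the translated base point `g·w` the letter is the conjugate `w_e⁻¹ L_j w_e`) — apply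
`CircleLaw d d 2` on a.e. coset (those on which `P ∘ orbit ≢ 0`; the others are `wt`-null);
(3) (Neg) step: `E_ν[(sup_{w ∈ 𝒲_m} ‖Q(g·w)‖)^{-s}] ≤ C_β E_ν[(sup_{w ∈ 𝒲_{m+1}} ‖Q(g·w)‖)^{-s}]`,
`𝒲_m` = words in the first `m` letters, using `(sup)^{-s} = inf (·)^{-s}` and
`E[inf_θ' X_θ'] ≤ inf_θ' E[X_θ']`; (Flat) step dually with `E[sup] ≥ sup E` (no measurable selection);
(4) after the `9·#R` letters of one surjective word per link (`stub_su3CircleWord`, LANDED;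
`stub_linkWordSurjective` pattern) the sup over words is the sup over the fibre; (5) integrability from
the per-circle integrability and Tonelli.  Leans on: Mathlib `MeasureTheory.Measure.pi`,
`IsMulRightInvariant` of Haar on a compact group, `MeasureTheory.integral_prod`, `intervalIntegral`,
`Real.rpow`; tree `haarProbability`, `wilsonAction`, the locality pattern `wilsonDirac_update_apply` of
`PauliWegnerSeaPauliBandLimit.lean`. -/
/- REGISTERED IN UNFOLDED VOCABULARY (no skeleton-local name): `IsTrigPoly`, `circleMean`, `CircleLaw`
inlined, so that the proof lands under `Theorems/` without importing this workfile; `circleLaw_all`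
below recovers `∀ d dJ dh, CircleLaw d dJ dh` by `exact` (definitional unfolding). -/
theorem stub_circleLaw : ∀ d dJ dh : ℕ,
    ∃ s₀ C p : ℝ, 0 < s₀ ∧ 0 < C ∧ ∀ (κ : ℝ) (h : ℝ → ℝ) (J Q : ℝ → ℂ),
      0 ≤ κ →
      (∃ c : ℤ → ℂ, ∀ θ : ℝ, (h θ : ℂ) =
        ∑ k ∈ Finset.Icc (-(dh : ℤ)) dh, c k * Complex.exp ((k : ℂ) * (θ : ℂ) * Complex.I)) →
      (∀ θ, |h θ| ≤ κ) →
      (∃ c : ℤ → ℂ, ∀ θ : ℝ, J θ =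
        ∑ k ∈ Finset.Icc (-(dJ : ℤ)) dJ, c k * Complex.exp ((k : ℂ) * (θ : ℂ) * Complex.I)) →
      (∃ θ, J θ ≠ 0) →
      (∃ c : ℤ → ℂ, ∀ θ : ℝ, Q θ =
        ∑ k ∈ Finset.Icc (-(d : ℤ)) d, c k * Complex.exp ((k : ℂ) * (θ : ℂ) * Complex.I)) →
      let w : ℝ → ℝ := fun θ => Real.exp (h θ) * ‖J θ‖
      (∀ θ₀ : ℝ, ‖Q θ₀‖ ≤ C * (1 + κ) ^ p *
        ((∫ θ in (0 : ℝ)..(2 * Real.pi), ‖Q θ‖ * w θ) / (∫ θ in (0 : ℝ)..(2 * Real.pi), w θ))) ∧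
      (∀ s : ℝ, 0 < s → s ≤ s₀ →
        IntervalIntegrable (fun θ => ‖Q θ‖ ^ (-s) * w θ) MeasureTheory.volume 0 (2 * Real.pi) ∧
        (∫ θ in (0 : ℝ)..(2 * Real.pi), ‖Q θ‖ ^ (-s) * w θ) / (∫ θ in (0 : ℝ)..(2 * Real.pi), w θ) ≤
          C * (1 + κ) ^ p * (⨆ θ : ℝ, ‖Q θ‖) ^ (-s)) := by
  sorry

/-- Def-based form of stub 1a (definitional unfolding of `CircleLaw`, `IsTrigPoly`, `circleMean`). -/
theorem circleLaw_all : ∀ d dJ dh : ℕ, CircleLaw d dJ dh :=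
  stub_circleLaw

/-- **stub 1b — the fibre band law FROM the circle law (L; the word iteration; measure theory on the
compact group `SU(3)^R` over landed tree tools — RESHAPE gen 1: the former single stub
`(∀ d dJ dh, CircleLaw d dJ dh) ∧ FibreBandLaw` is split into `stub_circleLaw` (the 1-D lever, held by the
lead) and this implication, so that the two halves are proved in parallel).**  Proof plan: steps (1)–(5) of
the FIBRE BAND LAW paragraph above (coset formula by right-invariance of product Haar + Fubini; the
conditional law on a letter orbit is a `CircleLaw d d 2` law; (Neg)/(Flat) steps by pushing `inf`/`sup`
through the next conditional expectation; a surjective nine-letter word per link, LANDED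
`stub_eulerWord`/`stub_su3CircleWord`; (AE) from the landed `HaarCurveStep`/`HaarWordIterate` machinery). -/
/- REGISTERED IN UNFOLDED VOCABULARY: hypothesis = the text of `stub_circleLaw`, conclusion =
`FibreBandLaw` with `IsFibrePoly`/`IsTrigPoly` inlined and `𝔾` spelled out; `fibreBandLaw_of_circleLaw`
below is the def-based form. -/
theorem stub_fibreBandLaw :
    (∀ d dJ dh : ℕ,
      ∃ s₀ C p : ℝ, 0 < s₀ ∧ 0 < C ∧ ∀ (κ : ℝ) (h : ℝ → ℝ) (J Q : ℝ → ℂ),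
        0 ≤ κ →
        (∃ c : ℤ → ℂ, ∀ θ : ℝ, (h θ : ℂ) =
          ∑ k ∈ Finset.Icc (-(dh : ℤ)) dh, c k * Complex.exp ((k : ℂ) * (θ : ℂ) * Complex.I)) →
        (∀ θ, |h θ| ≤ κ) →
        (∃ c : ℤ → ℂ, ∀ θ : ℝ, J θ =
          ∑ k ∈ Finset.Icc (-(dJ : ℤ)) dJ, c k * Complex.exp ((k : ℂ) * (θ : ℂ) * Complex.I)) →
        (∃ θ, J θ ≠ 0) →
        (∃ c : ℤ → ℂ, ∀ θ : ℝ, Q θ =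
          ∑ k ∈ Finset.Icc (-(d : ℤ)) d, c k * Complex.exp ((k : ℂ) * (θ : ℂ) * Complex.I)) →
        let w : ℝ → ℝ := fun θ => Real.exp (h θ) * ‖J θ‖
        (∀ θ₀ : ℝ, ‖Q θ₀‖ ≤ C * (1 + κ) ^ p *
          ((∫ θ in (0 : ℝ)..(2 * Real.pi), ‖Q θ‖ * w θ) / (∫ θ in (0 : ℝ)..(2 * Real.pi), w θ))) ∧
        (∀ s : ℝ, 0 < s → s ≤ s₀ →
          IntervalIntegrable (fun θ => ‖Q θ‖ ^ (-s) * w θ) MeasureTheory.volume 0 (2 * Real.pi) ∧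
          (∫ θ in (0 : ℝ)..(2 * Real.pi), ‖Q θ‖ ^ (-s) * w θ) / (∫ θ in (0 : ℝ)..(2 * Real.pi), w θ) ≤
            C * (1 + κ) ^ p * (⨆ θ : ℝ, ‖Q θ‖) ^ (-s))) →
    ∀ n d : ℕ, ∃ s₀ C p : ℝ, 0 < s₀ ∧ 0 < C ∧
      ∀ (N : ℕ) [NeZero N] (R : Finset (Edge 4 N)), R.card ≤ n →
      ∀ (U : GaugeConfig 4 N (Matrix.specialUnitaryGroup (Fin 3) ℂ)) (β : ℝ)
        (P Q : GaugeConfig 4 N (Matrix.specialUnitaryGroup (Fin 3) ℂ) → ℂ),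
      (Continuous P ∧ ∀ (W : GaugeConfig 4 N (Matrix.specialUnitaryGroup (Fin 3) ℂ)) (e : Edge 4 N)
          (V B : Matrix.specialUnitaryGroup (Fin 3) ℂ) (T : ℝ → Matrix.specialUnitaryGroup (Fin 3) ℂ),
        (∀ θ : ℝ, ((T θ : Matrix.specialUnitaryGroup (Fin 3) ℂ) : Matrix (Fin 3) (Fin 3) ℂ) =
          Matrix.diagonal ![Complex.exp (θ * Complex.I), Complex.exp (-(θ * Complex.I)), 1]) →
        ∃ c : ℤ → ℂ, ∀ θ : ℝ, P (Function.update W e (W e * (V * T θ * V⁻¹) * B)) =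
          ∑ k ∈ Finset.Icc (-(d : ℤ)) d, c k * Complex.exp ((k : ℂ) * (θ : ℂ) * Complex.I)) →
      (Continuous Q ∧ ∀ (W : GaugeConfig 4 N (Matrix.specialUnitaryGroup (Fin 3) ℂ)) (e : Edge 4 N)
          (V B : Matrix.specialUnitaryGroup (Fin 3) ℂ) (T : ℝ → Matrix.specialUnitaryGroup (Fin 3) ℂ),
        (∀ θ : ℝ, ((T θ : Matrix.specialUnitaryGroup (Fin 3) ℂ) : Matrix (Fin 3) (Fin 3) ℂ) =
          Matrix.diagonal ![Complex.exp (θ * Complex.I), Complex.exp (-(θ * Complex.I)), 1]) →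
        ∃ c : ℤ → ℂ, ∀ θ : ℝ, Q (Function.update W e (W e * (V * T θ * V⁻¹) * B)) =
          ∑ k ∈ Finset.Icc (-(d : ℤ)) d, c k * Complex.exp ((k : ℂ) * (θ : ℂ) * Complex.I)) →
      let refit : GaugeConfig 4 N (Matrix.specialUnitaryGroup (Fin 3) ℂ) →
          GaugeConfig 4 N (Matrix.specialUnitaryGroup (Fin 3) ℂ) := fun W e => if e ∈ R then W e else U e
      let wt : GaugeConfig 4 N (Matrix.specialUnitaryGroup (Fin 3) ℂ) → ℝ := fun W =>
        Real.exp (-(β * wilsonAction (fundamentalRep (Fin 3)) (refit W))) * ‖P (refit W)‖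
      let haar : MeasureTheory.Measure (GaugeConfig 4 N (Matrix.specialUnitaryGroup (Fin 3) ℂ)) :=
        MeasureTheory.Measure.pi fun _ => haarProbability (Matrix.specialUnitaryGroup (Fin 3) ℂ)
      let Z : ℝ := ∫ W, wt W ∂haar
      (∃ W, P (refit W) ≠ 0) →
        ((∃ W, Q (refit W) ≠ 0) → ∀ᵐ W ∂haar, Q (refit W) ≠ 0) ∧
        (∀ W₀ : GaugeConfig 4 N (Matrix.specialUnitaryGroup (Fin 3) ℂ),
          ‖Q (refit W₀)‖ ≤ C * (1 + |β|) ^ p * ((∫ W, ‖Q (refit W)‖ * wt W ∂haar) / Z)) ∧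
        (∀ s : ℝ, 0 < s → s ≤ s₀ →
          MeasureTheory.Integrable (fun W => ‖Q (refit W)‖ ^ (-s) * wt W) haar ∧
          (∫ W, ‖Q (refit W)‖ ^ (-s) * wt W ∂haar) / Z ≤
            C * (1 + |β|) ^ p * (⨆ W : GaugeConfig 4 N (Matrix.specialUnitaryGroup (Fin 3) ℂ), ‖Q (refit W)‖) ^ (-s)) := by
  sorry

/-- Def-based form of stub 1b (definitional unfolding). -/
theorem fibreBandLaw_of_circleLaw : (∀ d dJ dh : ℕ, CircleLaw d dJ dh) → FibreBandLaw :=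
  stub_fibreBandLaw

/-- **stub 2 — the deterministic inputs: uniform cofactor domination K1♭ AND side-matrix witnesses
(RESHAPE gen 1: `LocalCofactorDomination ∧ SideWitness`; L; deterministic linear algebra; the line's risk
concentrate, see `LocalCofactorDomination`, `SideWitness`; the `SideWitness` half is landable separately as a
registered sub-goal).**  Not this idea's mechanism but the deterministic input
every outward line consumes; = the lead's proposed restatement of route item K1
(`K2Repaired.FibreCofactorDominationUniform`) extended to admissible side matrices, `x = y` and
`m₀ ∈ [-9,1]` (trivial by Neumann series outside `(-8.1, 0.1)`).  Recommended to the tenure planner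
for PROMOTION to a route item (then this stub becomes an admissible hypothesis by name).  Route:
K1's ModeByMode/TwoStarSchur plan (`adj = det · G`, γ₅-hermiticity of `D_A`, two stars shake every mode
cored at `x` or `y`).  Cheapest falsifier: the route's next two-star test WITHOUT the `n_w` allowance;
even-box side matrices at `m₀ = -4`. -/
theorem stub_deterministic : LocalCofactorDomination ∧ SideWitness := by
  sorry

/-- **stub 3 — the two-star package from the fibre band law and K1♭ (M–L; replaces the picked line's
blocked `stub_twoStar`).**  `FibreBandLaw → LocalCofactorDomination → ∀ Nf, TwoStarBounds Nf` (the
packaged predicate of §2, VERBATIM the lead's: all `β ∈ ℝ`, probe mass `∈ [-9,1]`, all sea masses,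
all `S`).  Content: (b) band limits — `det`/adjugate entries of `sideMatrix A (wilsonD · m)` and
`det diracMatrix` are fibre polynomials of degree `4` / `4 N_f` (rank argument of the LANDED
`PauliWegnerSeaPauliBandLimit(DetRank)`: the `e^{±iθ}`-coefficients of `W_e V T(θ) V⁻¹ B` have rank one;
continuity: polynomial entries);
(c) conditioning of `ν_S = ‖det diracMatrix‖ · μ_W / Z` on the links off `star(x) ∪ star(y)` (density
`e^{-βS}` × product Haar; the conditional is the `FibreBandLaw` law with `R` = the `≤ 16` star links,
`P = det diracMatrix`), then per fibre: (T5) `E‖G_f(x,y)‖^s = E[‖adj_f‖^s |det_f|^{-s}] ≤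
(C₀ sup|det_f|)^s · C_β (sup|det_f|)^{-s}` (K1♭ + Neg); (Tdec) Cauchy–Schwarz, `E X² ≤ C₀^{2s} C_β` for
the depleted factor (K1♭ on the side matrix + Neg, `2s ≤ s₀`) and reverse Hölder
`(E Y²)^{1/2} ≤ 144 C_β^{3/2} E Y` for the full factor `Y = ‖adj_cd‖^s |det_f|^{-s}` (upper: Neg; lower:
Flat for the adjugate entry of largest sup and `|a|^s ≥ |a| sup^{s-1}`); (T1) = (T5) on the two-star
fibre of `(u', v)`, where the inside factor `‖G_W(x,u)‖^s` and the far factor `‖G_{Λᶜ}(v',y)‖^s` are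
CONSTANT (no link inside `W` or inside `Λᶜ` is incident to `u'` or `v`); (T0) `0 < Z` from the landed
a.e. non-vanishing of `det` (`stub_detNonvanishing` + one configuration with `det ≠ 0`, the lead's
`TwistedFreeWilsonDirac`), integrability of triple products by Hölder³ + Neg (`3s ≤ s₀`);
(d) integrate the fibre bounds over the outside (tower property); (e) the torus `S = 0` (`L = 1`, four
links) is INSIDE `FibreBandLaw` (second harmonics allowed, `dh = 2`).  Output exponent
`s₀ = s₀(FibreBandLaw 16 (4N_f+4))/3`.  Why it might fail: bookkeeping only; the mathematics that can
fail sits in stubs 1–2.  Size M–L in Lean (disintegration of `wilsonMeasure` over a link subset is the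
long part; `LatticeGaugeDLR` has the specification). -/
theorem stub_twoStar :
    FibreBandLaw → LocalCofactorDomination → SideWitness → ∀ Nf : ℕ, TwoStarBounds Nf := by
  sorry

/-- stub 4 (XL, HARDEST of the whole line; SHARED with the picked line, byte-identical — the one property of
the phase-quenched gauge measure replacing independence; held by the lead). K1, K3 stay as hypotheses
for registry identity; this line's (T0) no longer needs them. -/
theorem stub_farStability :
    Summit.QuantumFields.QCD.Theses.PauliWegnerSea.FibreCofactorDomination →
      Summit.QuantumFields.QCD.Theses.PauliWegnerSea.TiltedFlatness →
        ∀ Nf : ℕ, FarStability Nf := by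
  sorry

/-- stub 3 — CLOSED (landed p77083, `Theorems/PauliWegnerSeaFMClosureUnquenchedResolvent.lean`, 399 lines,
`cT = 4`: resolvent identities `M⁻¹ - N⁻¹ = N⁻¹ (N - M) M⁻¹ = M⁻¹ (N - M) N⁻¹`, block-diagonality of
`(D_A ⊕ 1)⁻¹`, support of the cross-cut hops on adjacent boundary pairs, expand-and-bound). Registered in
unfolded vocabulary (= `CollarResolventBounds` verbatim); the skeleton now imports the landed theorem. -/
theorem stub_resolvent :
    ∃ cT : ℝ, 0 < cT ∧ ∀ (S : ℕ) (U : GaugeConfig 4 (2 * S + 1) (Matrix.specialUnitaryGroup (Fin 3) ℂ))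
        (m₀ : ℝ) (x : TorusSite 4 (2 * S + 1)),
        let D : Matrix (TorusSite 4 (2 * S + 1) × Fin 3 × Fin 4) (TorusSite 4 (2 * S + 1) × Fin 3 × Fin 4) ℂ :=
          wilsonDirac (fundamentalRep (Fin 3)) U m₀ 1
        let bn : Matrix (TorusSite 4 (2 * S + 1) × Fin 3 × Fin 4) (TorusSite 4 (2 * S + 1) × Fin 3 × Fin 4) ℂ →
            TorusSite 4 (2 * S + 1) → TorusSite 4 (2 * S + 1) → ℝ :=
          fun M y z => ∑ a : Fin 3, ∑ i : Fin 4, ∑ b : Fin 3, ∑ j : Fin 4, ‖M (y, a, i) (z, b, j)‖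
        let side : Finset (TorusSite 4 (2 * S + 1)) →
            Matrix (TorusSite 4 (2 * S + 1) × Fin 3 × Fin 4) (TorusSite 4 (2 * S + 1) × Fin 3 × Fin 4) ℂ :=
          fun A => Matrix.of fun p q => if p.1 ∈ A ∧ q.1 ∈ A then D p q else if p = q then 1 else 0
        let ball : ℕ → Finset (TorusSite 4 (2 * S + 1)) := fun r =>
          (box 4 r).image fun w => x + Torus.proj (2 * S + 1) w
        let sphere : ℕ → Finset (TorusSite 4 (2 * S + 1)) := fun r =>
          ((box 4 r).filter fun w : Literature.Probability.LatticeModels.Site 4 =>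
              ∃ i, w i = (r : ℤ) ∨ w i = -(r : ℤ)).image
            fun w => x + Torus.proj (2 * S + 1) w
        let ebox : ℕ → Finset (TorusSite 4 (2 * S + 1)) := fun r =>
          (Fintype.piFinset fun _ : Fin 4 => Finset.Icc (-(r : ℤ) - 1) r).image
            fun w => x + Torus.proj (2 * S + 1) w
        let boxIn : ℕ → Finset (TorusSite 4 (2 * S + 1)) := fun r =>
          ((Fintype.piFinset fun _ : Fin 4 => Finset.Icc (-(r : ℤ) - 1) r).filter
              fun w : Literature.Probability.LatticeModels.Site 4 =>
                ∃ i, w i = -(r : ℤ) - 1 ∨ w i = (r : ℤ)).image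
            fun w => x + Torus.proj (2 * S + 1) w
        let boxOut : ℕ → Finset (TorusSite 4 (2 * S + 1)) := fun r =>
          ((Fintype.piFinset fun _ : Fin 4 => Finset.Icc (-(r : ℤ) - 2) (r + 1)).filter
              fun w : Literature.Probability.LatticeModels.Site 4 =>
                ∃ i, w i = -(r : ℤ) - 2 ∨ w i = (r : ℤ) + 1).image
            fun w => x + Torus.proj (2 * S + 1) w
        (∀ r : ℕ, 1 ≤ r → r + 1 ≤ S → ∀ z : TorusSite 4 (2 * S + 1), z ∉ ball r →
          (side ((ball r)ᶜ)).det ≠ 0 →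
            bn D⁻¹ x z ≤
              cT * ∑ p ∈ sphere r, ∑ p' ∈ sphere (r + 1), bn D⁻¹ x p * bn (side ((ball r)ᶜ))⁻¹ p' z) ∧
        ∀ ℓ : ℕ, 1 ≤ ℓ → ℓ + 2 ≤ S →
          (∀ u : TorusSite 4 (2 * S + 1), u ∈ ebox ℓ → D.det ≠ 0 →
            bn (side (ebox ℓ))⁻¹ x u ≤
              bn D⁻¹ x u +
                cT * ∑ w' ∈ boxOut ℓ, ∑ w ∈ boxIn ℓ, bn D⁻¹ x w' * bn (side (ebox ℓ))⁻¹ w u) ∧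
          (3 * ℓ + 4 ≤ S →
            (∀ v' y : TorusSite 4 (2 * S + 1), v' ∉ ebox (3 * ℓ + 2) → y ∉ ebox (3 * ℓ + 2) →
              D.det ≠ 0 →
                bn (side ((ebox (3 * ℓ + 2))ᶜ))⁻¹ v' y ≤
                  bn D⁻¹ v' y +
                    cT * ∑ w' ∈ boxOut (3 * ℓ + 2), ∑ w ∈ boxIn (3 * ℓ + 2),
                      bn (side ((ebox (3 * ℓ + 2))ᶜ))⁻¹ v' w' * bn D⁻¹ w y) ∧
            (∀ y : TorusSite 4 (2 * S + 1), y ∉ ebox (3 * ℓ + 2) →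
              (side (ebox ℓ)).det ≠ 0 → (side ((ebox (3 * ℓ + 2))ᶜ)).det ≠ 0 →
                bn D⁻¹ x y ≤
                  cT ^ 2 * ∑ u ∈ boxIn ℓ, ∑ u' ∈ boxOut ℓ,
                    ∑ v ∈ boxIn (3 * ℓ + 2), ∑ v' ∈ boxOut (3 * ℓ + 2),
                      bn (side (ebox ℓ))⁻¹ x u * bn D⁻¹ u' v *
                        bn (side ((ebox (3 * ℓ + 2))ᶜ))⁻¹ v' y)) :=
  _root_.Summit.QuantumFields.QCD.Theorems.ThickCollarFarStability.stub_resolvent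



/-- CLOSED stub of the picked line (landed p75265, `Theorems/PauliWegnerSeaFMClosureUnquenchedHopping.lean`, 308 lines:
Neumann series for both signs of `m₀ + 4`, `C = 1440`, `μ = log(41/40)`; `wilsonDirac_eq_sub_sum_wilsonHop`,
`l2_opNorm_wilsonHop_le`, the cyclic-distance toolkit of `WilsonPropagatorHeavyMass`). Registered in unfolded
vocabulary (= `∀ Nf, HoppingDecay Nf` verbatim); the skeleton now imports the landed theorem. -/
theorem stub_hopping : ∀ Nf : ℕ,
    ∃ C μ : ℝ, 0 ≤ C ∧ 0 < μ ∧ ∀ (β : ℝ) (mq : Fin Nf → ℝ) (f : Fin Nf), (41 / 10 : ℝ) ≤ |mq f + 4| →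
        ∀ (S : ℕ) (s : ℝ), 0 < s → s < 1 →
          ∀ v : Literature.Probability.LatticeModels.Site 4, v ∈ box 4 S →
            (∫ U : GaugeConfig 4 (2 * S + 1) (Matrix.specialUnitaryGroup (Fin 3) ℂ),
                ‖(diracMatrix U mq).det‖ *
                  (∑ a : Fin 3, ∑ i : Fin 4, ∑ b : Fin 3, ∑ j : Fin 4,
                    ‖(diracMatrix U mq)⁻¹ (quarkEquiv (f, (Torus.proj (2 * S + 1) 0, a, i)))
                      (quarkEquiv (f, (Torus.proj (2 * S + 1) (v), b, j)))‖) ^ s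
                ∂(wilsonMeasure (fundamentalRep (Fin 3)) β)) /
              (∫ U : GaugeConfig 4 (2 * S + 1) (Matrix.specialUnitaryGroup (Fin 3) ℂ),
                ‖(diracMatrix U mq).det‖ ∂(wilsonMeasure (fundamentalRep (Fin 3)) β)) ≤
            C * Real.exp (-(μ * s * ‖v‖)) :=
  _root_.Summit.QuantumFields.QCD.Theorems.ThickCollarFarStability.stub_hopping


/-- **stub 6 — the two over-quantified CORNERS of the crux as typed (RESHAPE gen 1: the former shared
stubs `stub_unitShell` (A5: `ℓ₀ = 1 ∧ β_k → 0`, a strong-coupling log-moment sign) and `stub_inward`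
(A6: the inward window `‖v‖ < ℓ₀(k)`, no mechanism off the reflection-positive locus) merged into ONE
registered statement; both are mooted by the restatement `K2Repaired` (`2 ≤ ℓ₀`, outward-only conclusion)
and neither is attacked by this line — they are carried so that the composition still concludes the crux
AS TYPED by name).** -/
theorem stub_corners :
    (∀ Nf : ℕ, UnitShellLowerBound Nf) ∧
      (∀ (Nf : ℕ) (reg : QCDRegularisation Nf) (m : Fin Nf → ℝ), (∀ f, 0 < m f) →
        InwardExtension Nf reg m) := by
  sorry

/-- stub 7 (SHARED with the picked line, byte-identical; L as formalisation, M as mathematics — ASFH Thm 2/3 transplanted): from the five inputs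
and the typed `Input`, (a) lower the input's exponent to `s' = min(s, s₀, s₀')` by Jensen (ν is a
probability measure; T0), keeping room `q s₀`; (b) translation invariance of `pqE` (input at centre `0`
⇒ at every centre); (c) flavour reduction `(diracMatrix U mq)⁻¹ ↦ (wilsonD U (mq f))⁻¹` under the
weight; (d) per step `k` and flavour `f`: hopping window ⇒ `stub_hopping` (`ℓ₀' = 0`); else if
`ℓ₀(k) = 1 ∧ |β_k| ≤ β₀` ⇒ contradiction with `stub_unitShell`; else `Θ_k = ℓ₀(1+|β_k|) ≥
min(2, 1+β₀) > 1` and the bootstrap runs: conversion of the shell input into the exit moment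
(Rin + Tdec + one forward step Rfwd + Tdec), one-step same-domain subharmonicity for
`y ∉ Λ(x) = ebox(x,3ℓ₀+2)` (R2 + T1 + FarStability + Rout + Tdec) with `b_k ≤ C Θ_k^{c - θ q s₀}`,
choice of ONE `q` making `Ξ₀ b_k ≤ 1` and `b_k ≤ 1/2`, iteration ⇒ `E ≤ b_k^{‖v‖/(3ℓ₀+4)}` for
`‖v‖ ≥ 3ℓ₀+5`, the no-rate one-step bound (Rfwd + Tdec) on `ℓ₀ < ‖v‖ ≤ 3ℓ₀+4` (and on the whole
exterior when the collar does not fit), and the rate arithmetic `|log b_k|/(3ℓ₀+4) ≥ δ a_k` from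
`ℓ₀ a_k ≤ K₀(1+|log a_k|)`; (e) a.e. invertibility of the side matrices actually inverted.
Output: `OutwardDecayWith` with `ℓ₀'(k,f) ∈ {0, ℓ₀(k)}`. Held by the lead. -/
theorem stub_closure :
    ∀ (Nf : ℕ) (reg : QCDRegularisation Nf) (m : Fin Nf → ℝ), (∀ f, 0 < m f) →
      TwoStarBounds Nf → FarStability Nf → CollarResolventBounds → UnitShellLowerBound Nf →
        HoppingDecay Nf → Input Nf reg m →
          ∃ (s δ C K₀ : ℝ) (ℓ₀ : ℕ → Fin Nf → ℕ), OutwardDecayWith Nf reg m s δ C K₀ ℓ₀ := by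
  sorry

/-! ## §5 Kernel-checked composition -/

/-- Merging the outward and inward packages at a common exponent `s` into the crux's `Conclusion`
(`δ = min`, `C = max`; pure bookkeeping, proved). -/
theorem conclusion_of_outward_inward {Nf : ℕ} (reg : QCDRegularisation Nf) (m : Fin Nf → ℝ)
    {s δ C K₀ δ' C' : ℝ} {ℓ₀ : ℕ → Fin Nf → ℕ}
    (hout : OutwardDecayWith Nf reg m s δ C K₀ ℓ₀) (hin : InwardDecayWith Nf reg m s δ' C' ℓ₀) :
    Conclusion Nf reg m := by
  obtain ⟨hs0, hs1, hδ, hC, -, -, hev⟩ := hout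
  obtain ⟨hδ', hC', hev'⟩ := hin
  refine ⟨s, min δ δ', max C C', hs0, hs1, lt_min hδ hδ', ?_⟩
  filter_upwards [hev, hev'] with k hk hk' S hS f v hv
  have ht : 0 ≤ reg.a k * ‖v‖ := mul_nonneg (reg.a_pos k).le (norm_nonneg v)
  have hmax : 0 ≤ max C C' := le_trans hC (le_max_left _ _)
  by_cases h : (ℓ₀ k f : ℝ) ≤ ‖v‖
  · calc cruxMoment Nf (reg.β k) (bareMass reg m k) S f v s
          ≤ C * Real.exp (-(δ * (reg.a k * ‖v‖))) := hk S hS f v hv h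
      _ ≤ max C C' * Real.exp (-(min δ δ' * (reg.a k * ‖v‖))) := by
          apply mul_le_mul (le_max_left _ _) _ (Real.exp_pos _).le hmax
          exact Real.exp_le_exp.mpr (neg_le_neg (mul_le_mul_of_nonneg_right (min_le_left _ _) ht))
  · have h : ‖v‖ < (ℓ₀ k f : ℝ) := lt_of_not_ge h
    calc cruxMoment Nf (reg.β k) (bareMass reg m k) S f v s
          ≤ C' * Real.exp (-(δ' * (reg.a k * ‖v‖))) := hk' S hS f v hv h
      _ ≤ max C C' * Real.exp (-(min δ δ' * (reg.a k * ‖v‖))) := by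
          apply mul_le_mul (le_max_right _ _) _ (Real.exp_pos _).le hmax
          exact Real.exp_le_exp.mpr (neg_le_neg (mul_le_mul_of_nonneg_right (min_le_right _ _) ht))

/-- **Composition.** The seven stub statements imply the crux BY NAME. Pure logic after the defeq
`crux_iff`: the circle law feeds the fibre band law, which with K1♭ feeds the two-star package; the
closure turns (two-star, far stability, resolvent algebra [landed], unit-shell corner, hopping window
[landed], input) into the outward package, the inward corner supplies the complementary package at the
same exponent, and `conclusion_of_outward_inward` merges them.  K1 and K3 (the crux's own hypotheses) are
consumed by `stub_farStability` (registry identity with the picked line).  The hypotheses are, in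
order, literally the types of `stub_circleLaw`, `stub_fibreBandLaw`, `stub_deterministic`,
`stub_twoStar`, `stub_farStability`, `stub_corners`, `stub_closure`. -/
theorem FMClosureUnquenched_of :
    (∀ d dJ dh : ℕ, CircleLaw d dJ dh) →
    ((∀ d dJ dh : ℕ, CircleLaw d dJ dh) → FibreBandLaw) →
    (LocalCofactorDomination ∧ SideWitness) →
    (FibreBandLaw → LocalCofactorDomination → SideWitness → ∀ Nf : ℕ, TwoStarBounds Nf) →
    (Summit.QuantumFields.QCD.Theses.PauliWegnerSea.FibreCofactorDomination →
      Summit.QuantumFields.QCD.Theses.PauliWegnerSea.TiltedFlatness → ∀ Nf : ℕ, FarStability Nf) →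
    ((∀ Nf : ℕ, UnitShellLowerBound Nf) ∧
      (∀ (Nf : ℕ) (reg : QCDRegularisation Nf) (m : Fin Nf → ℝ), (∀ f, 0 < m f) →
        InwardExtension Nf reg m)) →
    (∀ (Nf : ℕ) (reg : QCDRegularisation Nf) (m : Fin Nf → ℝ), (∀ f, 0 < m f) →
      TwoStarBounds Nf → FarStability Nf → CollarResolventBounds → UnitShellLowerBound Nf →
        HoppingDecay Nf → Input Nf reg m →
          ∃ (s δ C K₀ : ℝ) (ℓ₀ : ℕ → Fin Nf → ℕ), OutwardDecayWith Nf reg m s δ C K₀ ℓ₀) →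
    Summit.QuantumFields.QCD.Theses.PauliWegnerSea.FMClosureUnquenched := by
  intro h1 h2 h3 h4 h5 h6 h7
  rw [crux_iff]
  intro hK1 hK3 Nf reg m hm hin
  have hT : TwoStarBounds Nf := h4 (h2 h1) h3.1 h3.2 Nf
  obtain ⟨s, δ, C, K₀, ℓ₀, hout⟩ :=
    h7 Nf reg m hm hT (h5 hK1 hK3 Nf) stub_resolvent (h6.1 Nf) (stub_hopping Nf) hin
  obtain ⟨δ', C', hinw⟩ := h6.2 Nf reg m hm hT hin s δ C K₀ ℓ₀ hout
  exact conclusion_of_outward_inward reg m hout hinw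

/-- The composition instantiated with the registered stubs (so that, once every `stub_*` is proved,
this very term closes the crux). -/
theorem FMClosureUnquenched_of_stubs :
    Summit.QuantumFields.QCD.Theses.PauliWegnerSea.FMClosureUnquenched :=
  FMClosureUnquenched_of circleLaw_all fibreBandLaw_of_circleLaw stub_deterministic stub_twoStar
    stub_farStability stub_corners stub_closure

/-- The fibre half alone, for the lead's registry: the picked line's `stub_twoStar` statement
(`K1 → K3 → ∀ Nf, TwoStarBounds Nf`) follows from stubs 1a, 1b, 2, 3 (K1, K3 unused). -/
theorem twoStar_of_circles (h1 : ∀ d dJ dh : ℕ, CircleLaw d dJ dh)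
    (h1b : (∀ d dJ dh : ℕ, CircleLaw d dJ dh) → FibreBandLaw)
    (h2 : LocalCofactorDomination ∧ SideWitness)
    (h3 : FibreBandLaw → LocalCofactorDomination → SideWitness → ∀ Nf : ℕ, TwoStarBounds Nf) :
    Summit.QuantumFields.QCD.Theses.PauliWegnerSea.FibreCofactorDomination →
      Summit.QuantumFields.QCD.Theses.PauliWegnerSea.TiltedFlatness →
        ∀ Nf : ℕ, TwoStarBounds Nf :=
  fun _ _ => h3 (h1b h1) h2.1 h2.2

end Summit.QuantumFields.QCD.Cruxes.FMClosureUnquenched.VonMisesCircles
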